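import Literature.Barriers.AtomisticToContinuum.DisorderedHarmonicChainDensityUpperBounds
import Literature.Barriers.AtomisticToContinuum.DisorderedHarmonicChainMartingale
import HarnessLib

/-!
# Ajanki–Huveneers 2011: the error terms of the integration by parts are `𝒪(1/(w√n))`

Part of the integration-by-parts route to the upper bound (5.1) of Prop. 5.1 of O. Ajanki,
F. Huveneers, CMP **301** (2011) 841–883, arXiv:1003.1076 (`…DensityUpperDefs.lean`,
`…DensityUpperBounds.lean`). With `Q = e^{T}/J_n`, the cutoff level `L` (`χ_L(N_{m₁})`,
`N_n ≥ N_{m₁} > L` on its support, so `(U+ε)⁻¹ ≤ 1/(J_nL)` there) and the pointwise bounds of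
`…DensityUpperBounds.lean`, PROVED here:

* pointwise majorants of `|∑a_kℓ(B_k)| |Ψ_ε|` and of `|G(X_n)| |VΨ_ε - g(X_n)e^Tχ U/(U+ε)|` by
  `Q × {|∑a_kℓ(B_k)|, |M₂|, |M₃|, ∑J_k}` (`pointwise_ellPsi_le`, `pointwise_err_le`);
* the AM–GM step `2Q|M| ≤ tM² + Q²/t` and **the bound of the `ε`-regularised integration by
  parts in terms of second moments** (`integral_core_le`): given `𝔼J_i², 𝔼Q² = 𝒪(1)`,
  `𝔼(∑a_kℓ(B_k))² = 𝒪(n/w²)` and `𝔼M₂², 𝔼M₃² = 𝒪(n³)` (martingale transforms), one gets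
  `|𝔼[g(X_n) e^T χ U/(U+ε)]| ≤ sup|G| · K₁/(w√n)` uniformly in `ε > 0`.

[cite: AjankiHuveneers2011, Prop. 5.1 eq. (5.1); Lemma 4.2 (martingale structure); folklore (Malliavin-type integration by parts)]
-/

noncomputable section

open Real MeasureTheory Set Filter Function Finset
open scoped ENNReal

namespace Literature.Barriers.AtomisticToContinuum.HeatConduction

/-! ### The cutoff forces `U ≥ J_n L` -/

section Cutoff

variable {w x : ℝ} (B : ℕ → ℝ) {ξ : ℝ → ℝ} {L ε : ℝ} {m m₁ : ℕ}

/-- On `{N_{m₁} > L}`: `U_m ≥ J_m L`, `U_m ≥ J_m N_m > 0` (`ξ ≥ 0`, `m₁ ≤ m`, `L > 0`). [folklore] -/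
theorem duU_ge_of_lt (hξ0 : ∀ b, 0 ≤ ξ b) (hm₁ : m₁ ≤ m) (hL : 0 < L) (hN : L < vaN w x B ξ m₁) :
    vaJ w x B m * L ≤ duU w x B ξ m ∧ 0 < duU w x B ξ m ∧ L < vaN w x B ξ m := by
  have hmono := vaN_mono B w x hξ0 hm₁ (ξ := ξ)
  have hJ := vaJ_pos w x B m
  have hNm : L < vaN w x B ξ m := hN.trans_le hmono
  unfold duU
  refine ⟨mul_le_mul_of_nonneg_left hNm.le hJ.le, mul_pos hJ (hL.trans hNm), hNm⟩

/-- **`χ_L(N_{m₁}) (U+ε)⁻¹ ≤ 1/(J_m L)`.** [folklore] -/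
theorem duChi_mul_inv_le (hξ0 : ∀ b, 0 ≤ ξ b) (hm₁ : m₁ ≤ m) (hL : 0 < L) (hε : 0 < ε) :
    duChi L (vaN w x B ξ m₁) * (duU w x B ξ m + ε)⁻¹ ≤ 1 / (vaJ w x B m * L) := by
  have hJ := vaJ_pos w x B m
  have hχ := duChi_mem L (vaN w x B ξ m₁)
  rcases hχ.1.eq_or_lt with h0 | hpos
  · rw [← h0, zero_mul]; positivity
  · obtain ⟨hU, hU0, -⟩ := duU_ge_of_lt B hξ0 hm₁ hL (lt_of_duChi_pos hL hpos)
    have hR : (duU w x B ξ m + ε)⁻¹ ≤ 1 / (vaJ w x B m * L) := by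
      rw [inv_eq_one_div]
      exact one_div_le_one_div_of_le (by positivity) (by linarith)
    calc duChi L (vaN w x B ξ m₁) * (duU w x B ξ m + ε)⁻¹ ≤ 1 * (1 / (vaJ w x B m * L)) :=
          mul_le_mul hχ.2 hR (by positivity) zero_le_one
      _ = 1 / (vaJ w x B m * L) := one_mul _

/-- **`|χ_L'(N_{m₁})| (U+ε)⁻¹ ≤ (C_χ/L)/(J_m L)`.** [folklore] -/
theorem abs_duDChi_mul_inv_le (hξ0 : ∀ b, 0 ≤ ξ b) (hm₁ : m₁ ≤ m) (hL : 0 < L) (hε : 0 < ε) {Cχ : ℝ}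
    (hCχ : ∀ s, |duDChi L s| ≤ Cχ / L) (hsupp : ∀ s, duDChi L s ≠ 0 → L < s ∧ s < 2 * L) :
    |duDChi L (vaN w x B ξ m₁)| * (duU w x B ξ m + ε)⁻¹ ≤ Cχ / L / (vaJ w x B m * L) := by
  have hJ := vaJ_pos w x B m
  have hC0 : 0 ≤ Cχ / L := (abs_nonneg _).trans (hCχ 0)
  by_cases h0 : duDChi L (vaN w x B ξ m₁) = 0
  · rw [h0, abs_zero, zero_mul]; positivity
  · obtain ⟨hlt, -⟩ := hsupp _ h0
    obtain ⟨hU, hU0, -⟩ := duU_ge_of_lt B hξ0 hm₁ hL hlt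
    have hR : (duU w x B ξ m + ε)⁻¹ ≤ 1 / (vaJ w x B m * L) := by
      rw [inv_eq_one_div]
      exact one_div_le_one_div_of_le (by positivity) (by linarith)
    calc |duDChi L (vaN w x B ξ m₁)| * (duU w x B ξ m + ε)⁻¹ ≤ (Cχ / L) * (1 / (vaJ w x B m * L)) :=
          mul_le_mul (hCχ _) hR (by positivity) hC0
      _ = Cχ / L / (vaJ w x B m * L) := by ring

/-- **`χ_L(N_{m₁}) (U+ε)⁻² J_m (a N_m + b) ≤ a/(J_mL) + b/(J_mL²)`** for `a, b ≥ 0`. [folklore] -/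
theorem duChi_mul_inv_sq_le (hξ0 : ∀ b, 0 ≤ ξ b) (hm₁ : m₁ ≤ m) (hL : 0 < L) (hε : 0 < ε) {a c : ℝ}
    (ha : 0 ≤ a) (hc : 0 ≤ c) :
    duChi L (vaN w x B ξ m₁) * ((duU w x B ξ m + ε)⁻¹) ^ 2 * (vaJ w x B m * (a * vaN w x B ξ m + c)) ≤
      a / (vaJ w x B m * L) + c / (vaJ w x B m * L ^ 2) := by
  have hJ := vaJ_pos w x B m
  have hχ := duChi_mem L (vaN w x B ξ m₁)
  rcases hχ.1.eq_or_lt with h0 | hpos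
  · rw [← h0, zero_mul, zero_mul]; positivity
  · obtain ⟨hU, hU0, hNm⟩ := duU_ge_of_lt B hξ0 hm₁ hL (lt_of_duChi_pos hL hpos)
    have hN0 : 0 < vaN w x B ξ m := hL.trans hNm
    have hR : (duU w x B ξ m + ε)⁻¹ ≤ (duU w x B ξ m)⁻¹ := by
      rw [inv_le_inv₀ (by positivity) hU0]; linarith
    have hR0 : 0 ≤ (duU w x B ξ m + ε)⁻¹ := by positivity
    have hUeq : duU w x B ξ m = vaJ w x B m * vaN w x B ξ m := rfl
    calc duChi L (vaN w x B ξ m₁) * ((duU w x B ξ m + ε)⁻¹) ^ 2 * (vaJ w x B m * (a * vaN w x B ξ m + c))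
        ≤ 1 * ((duU w x B ξ m)⁻¹) ^ 2 * (vaJ w x B m * (a * vaN w x B ξ m + c)) := by
          refine mul_le_mul_of_nonneg_right (mul_le_mul hχ.2 (pow_le_pow_left₀ hR0 hR 2)
            (by positivity) zero_le_one) (by positivity)
      _ = a / (vaJ w x B m * vaN w x B ξ m) + c / (vaJ w x B m * vaN w x B ξ m ^ 2) := by
          rw [hUeq]; field_simp
      _ ≤ a / (vaJ w x B m * L) + c / (vaJ w x B m * L ^ 2) := by
          refine add_le_add ?_ ?_
          · exact div_le_div_of_nonneg_left ha (by positivity) (mul_le_mul_of_nonneg_left hNm.le hJ.le)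
          · exact div_le_div_of_nonneg_left hc (by positivity)
              (mul_le_mul_of_nonneg_left (pow_le_pow_left₀ hL.le hNm.le 2) hJ.le)

end Cutoff

/-! ### Pointwise majorants of the two error terms -/

section Pointwise

variable {w x M : ℝ} (B : ℕ → ℝ) {h ξ G g : ℝ → ℝ} {L ε : ℝ} {m m₁ : ℕ}

/-- **`|∑a_kℓ_k| |Ψ_ε| ≤ (A_G/L) Q |∑a_kℓ_k|`**, `Q = e^T/J_m`. [folklore] -/
theorem pointwise_ellPsi_le (hξ0 : ∀ b, 0 ≤ ξ b) (hm₁ : m₁ ≤ m) (hL : 0 < L) (hε : 0 < ε) {AG : ℝ}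
    (hAG : ∀ y, |G y| ≤ AG) (La : ℝ) :
    |La * duPsi w x h ξ G m m₁ L ε B| ≤
      AG / L * (Real.exp (duT w x h B m) / vaJ w x B m) * |La| := by
  have hJ := vaJ_pos w x B m
  have hE := Real.exp_pos (duT w x h B m)
  have h1 := duChi_mul_inv_le B hξ0 hm₁ hL hε (w := w) (x := x)
  have hχ := duChi_mem L (vaN w x B ξ m₁)
  have hR0 : 0 ≤ (duU w x B ξ m + ε)⁻¹ := (inv_pos.mpr (duU_add_pos w x B hξ0 hε m)).le
  unfold duPsi
  rw [abs_mul, abs_mul, abs_mul, abs_mul, abs_of_pos hE, abs_of_nonneg hχ.1, abs_of_nonneg hR0]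
  calc |La| * (|G (ahPhase w x B m)| * Real.exp (duT w x h B m) * duChi L (vaN w x B ξ m₁) *
        (duU w x B ξ m + ε)⁻¹)
      = |La| * |G (ahPhase w x B m)| * Real.exp (duT w x h B m) *
          (duChi L (vaN w x B ξ m₁) * (duU w x B ξ m + ε)⁻¹) := by ring
    _ ≤ |La| * AG * Real.exp (duT w x h B m) * (1 / (vaJ w x B m * L)) := by
        refine mul_le_mul (mul_le_mul_of_nonneg_right (mul_le_mul_of_nonneg_left (hAG _) (abs_nonneg _))
          hE.le) h1 (mul_nonneg hχ.1 hR0) (by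
            have : 0 ≤ AG := (abs_nonneg _).trans (hAG 0)
            positivity)
    _ = AG / L * (Real.exp (duT w x h B m) / vaJ w x B m) * |La| := by field_simp

/-- **The pointwise majorant of `|G(X_m)| × |error bracket of VΨ_ε|`** (small regime, `0 ≤ ξ ≤ 1`,
`|ξ'| ≤ Ξ`, `|h| ≤ H`, `|G| ≤ A_G`, `|χ_L'| ≤ C_χ/L` supported in `(L, 2L)`):
`≤ A_G Q {(w|M₃| + 2H∑J)/L + (C_χ/L²)(VN-majorant at m₁) + (4πc|M₂| + (56πc²M²m + 6π)∑J)/L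
+ (VN-majorant at m)/L²}`, `Q = e^T/J_m`. [folklore] -/
theorem pointwise_err_le (hM : 0 ≤ M) (hw0 : 0 < w) (hw : w ≤ pcW M) (hB : ∀ i, |B i| ≤ M)
    (hξ0 : ∀ b, 0 ≤ ξ b) (hξ1 : ∀ b, ξ b ≤ 1) {Ξ : ℝ} (hΞ : ∀ b, |deriv ξ b| ≤ Ξ)
    {H : ℝ} (hH : ∀ y, |h y| ≤ H) {AG : ℝ} (hAG : ∀ y, |G y| ≤ AG)
    (hm₁ : m₁ ≤ m) (hL : 0 < L) (hε : 0 < ε) {Cχ : ℝ}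
    (hCχ : ∀ s, |duDChi L s| ≤ Cχ / L) (hsupp : ∀ s, duDChi L s ≠ 0 → L < s ∧ s < 2 * L) :
    |G (ahPhase w x B m) *
        (Real.exp (duT w x h B m) * (∑ k ∈ Finset.range m, vaW w x B ξ k * duDT w x h B m k) *
            duChi L (vaN w x B ξ m₁) * (duU w x B ξ m + ε)⁻¹ +
          Real.exp (duT w x h B m) * (duDChi L (vaN w x B ξ m₁) *
            ∑ k ∈ Finset.range m, vaW w x B ξ k * vaDN w x B ξ k m₁) * (duU w x B ξ m + ε)⁻¹ +
          Real.exp (duT w x h B m) * duChi L (vaN w x B ξ m₁) *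
            (-(∑ k ∈ Finset.range m, vaW w x B ξ k * duDU w x B ξ m k) / (duU w x B ξ m + ε) ^ 2))| ≤
      AG * (Real.exp (duT w x h B m) / vaJ w x B m) *
        ((w * |∑ j ∈ Finset.range m, deriv h (ahPhase w x B j) * B j * (vaJ w x B j * vaN w x B ξ j)| +
            2 * H * ∑ k ∈ Finset.range m, vaJ w x B k) / L +
          Cχ / L / L * (2 * π * Ξ / igC w * ∑ k ∈ Finset.range m₁, vaJ w x B k +
            4 * π * ∑ i ∈ Finset.range m₁, (i : ℝ) * vaJ w x B i) +
          (4 * π * igC w *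
              |∑ i ∈ Finset.range m, B i * Real.cos (2 * π * ahPhase w x B i) * (vaJ w x B i * vaN w x B ξ i)| +
            (56 * π * igC w ^ 2 * M ^ 2 * m + 6 * π) * ∑ i ∈ Finset.range m, vaJ w x B i) / L +
          (2 * π * Ξ / igC w * ∑ k ∈ Finset.range m, vaJ w x B k +
            4 * π * ∑ i ∈ Finset.range m, (i : ℝ) * vaJ w x B i) / L ^ 2) := by
  obtain ⟨hw2, -, -⟩ := pc_small hM hw0.le hw (hB 0)
  have hwπ : π * w / 2 < 1 := by linarith
  have hJ := vaJ_pos w x B m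
  have hE := Real.exp_pos (duT w x h B m)
  have hc := igC_pos hw0 hwπ
  have hAG0 : 0 ≤ AG := (abs_nonneg _).trans (hAG 0)
  have hH0 : 0 ≤ H := (abs_nonneg _).trans (hH 0)
  have hΞ0 : 0 ≤ Ξ := (abs_nonneg _).trans (hΞ 0)
  have hCχ0 : 0 ≤ Cχ / L := (abs_nonneg _).trans (hCχ 0)
  have hχ := duChi_mem L (vaN w x B ξ m₁)
  have hR0 : 0 ≤ (duU w x B ξ m + ε)⁻¹ := (inv_pos.mpr (duU_add_pos w x B hξ0 hε m)).le
  have hJsum0 : ∀ j, 0 ≤ ∑ k ∈ Finset.range j, vaJ w x B k := fun j =>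
    Finset.sum_nonneg fun k _ => (vaJ_pos w x B k).le
  have hiJsum0 : ∀ j, 0 ≤ ∑ i ∈ Finset.range j, (i : ℝ) * vaJ w x B i := fun j =>
    Finset.sum_nonneg fun i _ => mul_nonneg (Nat.cast_nonneg _) (vaJ_pos w x B i).le
  -- the three first variations
  set VT := ∑ k ∈ Finset.range m, vaW w x B ξ k * duDT w x h B m k with hVT
  set VN := ∑ k ∈ Finset.range m, vaW w x B ξ k * vaDN w x B ξ k m₁ with hVN
  set VU := ∑ k ∈ Finset.range m, vaW w x B ξ k * duDU w x B ξ m k with hVU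
  set M3 := ∑ j ∈ Finset.range m, deriv h (ahPhase w x B j) * B j * (vaJ w x B j * vaN w x B ξ j) with hM3
  set M2 := ∑ i ∈ Finset.range m, B i * Real.cos (2 * π * ahPhase w x B i) * (vaJ w x B i * vaN w x B ξ i) with hM2
  set SJ := ∑ k ∈ Finset.range m, vaJ w x B k with hSJ
  set SJ₁ := ∑ k ∈ Finset.range m₁, vaJ w x B k with hSJ₁
  set SiJ := ∑ i ∈ Finset.range m, (i : ℝ) * vaJ w x B i with hSiJ
  set SiJ₁ := ∑ i ∈ Finset.range m₁, (i : ℝ) * vaJ w x B i with hSiJ₁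
  have hPT : |VT| ≤ w * |M3| + 2 * H * SJ := abs_sum_vaW_mul_duDT_le (x := x) B hw0 hwπ hξ0 hξ1 hH le_rfl
  have hPN : |VN| ≤ 2 * π * Ξ / igC w * SJ₁ + 4 * π * SiJ₁ :=
    abs_sum_vaW_mul_vaDN_le (x := x) B hw0 hwπ hξ0 hξ1 hΞ hm₁
  set aU : ℝ := 4 * π * igC w * |M2| + (56 * π * igC w ^ 2 * M ^ 2 * m + 6 * π) * SJ with haU
  set cU : ℝ := 2 * π * Ξ / igC w * SJ + 4 * π * SiJ with hcU
  have haU0 : 0 ≤ aU := by rw [haU]; have := hJsum0 m; positivity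
  have hcU0 : 0 ≤ cU := by rw [hcU]; have := hJsum0 m; have := hiJsum0 m; positivity
  have hPU : |VU| ≤ vaJ w x B m * (aU * vaN w x B ξ m + cU) :=
    abs_sum_vaW_mul_duDU_le (x := x) B hM hw0 hw hB hξ0 hξ1 hΞ m
  -- the cutoff bounds
  have hE1 := duChi_mul_inv_le B hξ0 hm₁ hL hε (w := w) (x := x)
  have hE2 := abs_duDChi_mul_inv_le B hξ0 hm₁ hL hε hCχ hsupp (w := w) (x := x)
  have hE3 := duChi_mul_inv_sq_le B hξ0 hm₁ hL hε haU0 hcU0 (w := w) (x := x)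
  set E := Real.exp (duT w x h B m) with hEdef
  set χv := duChi L (vaN w x B ξ m₁) with hχv
  set χd := duDChi L (vaN w x B ξ m₁) with hχd
  set R := (duU w x B ξ m + ε)⁻¹ with hRdef
  -- term by term
  have hT1 : |E * VT * χv * R| ≤ E / vaJ w x B m * ((w * |M3| + 2 * H * SJ) / L) := by
    rw [abs_mul, abs_mul, abs_mul, abs_of_pos hE, abs_of_nonneg hχ.1, abs_of_nonneg hR0]
    calc E * |VT| * χv * R = E * |VT| * (χv * R) := by ring
      _ ≤ E * (w * |M3| + 2 * H * SJ) * (1 / (vaJ w x B m * L)) :=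
          mul_le_mul (mul_le_mul_of_nonneg_left hPT hE.le) hE1 (mul_nonneg hχ.1 hR0) (by
            have := hJsum0 m; positivity)
      _ = E / vaJ w x B m * ((w * |M3| + 2 * H * SJ) / L) := by field_simp
  have hT2 : |E * (χd * VN) * R| ≤ E / vaJ w x B m * (Cχ / L / L * (2 * π * Ξ / igC w * SJ₁ + 4 * π * SiJ₁)) := by
    rw [abs_mul, abs_mul, abs_mul, abs_of_pos hE, abs_of_nonneg hR0]
    have hb0 : 0 ≤ 2 * π * Ξ / igC w * SJ₁ + 4 * π * SiJ₁ := by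
      have := hJsum0 m₁; have := hiJsum0 m₁; positivity
    calc E * (|χd| * |VN|) * R = E * (|χd| * R) * |VN| := by ring
      _ ≤ E * (Cχ / L / (vaJ w x B m * L)) * (2 * π * Ξ / igC w * SJ₁ + 4 * π * SiJ₁) :=
          mul_le_mul (mul_le_mul_of_nonneg_left hE2 hE.le) hPN (abs_nonneg _) (by positivity)
      _ = E / vaJ w x B m * (Cχ / L / L * (2 * π * Ξ / igC w * SJ₁ + 4 * π * SiJ₁)) := by
          field_simp
  have hT3 : |E * χv * (-VU / (duU w x B ξ m + ε) ^ 2)| ≤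
      E / vaJ w x B m * (aU / L + cU / L ^ 2) := by
    rw [abs_mul, abs_mul, abs_of_pos hE, abs_of_nonneg hχ.1, abs_div, abs_neg,
      abs_of_nonneg (by positivity : (0:ℝ) ≤ (duU w x B ξ m + ε) ^ 2)]
    have hsq : (duU w x B ξ m + ε) ^ 2 = (R ^ 2)⁻¹ := by rw [hRdef, inv_pow, inv_inv]
    rw [hsq, div_inv_eq_mul]
    calc E * χv * (|VU| * R ^ 2) = E * (χv * R ^ 2 * |VU|) := by ring
      _ ≤ E * (χv * R ^ 2 * (vaJ w x B m * (aU * vaN w x B ξ m + cU))) :=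
          mul_le_mul_of_nonneg_left (mul_le_mul_of_nonneg_left hPU (mul_nonneg hχ.1 (sq_nonneg _))) hE.le
      _ ≤ E * (aU / (vaJ w x B m * L) + cU / (vaJ w x B m * L ^ 2)) := mul_le_mul_of_nonneg_left hE3 hE.le
      _ = E / vaJ w x B m * (aU / L + cU / L ^ 2) := by field_simp
  -- assemble
  rw [abs_mul]
  have hsum := (abs_add_le _ _).trans (add_le_add ((abs_add_le _ _).trans (add_le_add hT1 hT2)) hT3)
  calc |G (ahPhase w x B m)| * |E * VT * χv * R + E * (χd * VN) * R + E * χv * (-VU / (duU w x B ξ m + ε) ^ 2)|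
      ≤ AG * (E / vaJ w x B m * ((w * |M3| + 2 * H * SJ) / L) +
          E / vaJ w x B m * (Cχ / L / L * (2 * π * Ξ / igC w * SJ₁ + 4 * π * SiJ₁)) +
          E / vaJ w x B m * (aU / L + cU / L ^ 2)) :=
        mul_le_mul (hAG _) hsum (abs_nonneg _) hAG0
    _ = _ := by rw [haU, hcU]; ring

/-- **AM–GM**: `2 q |f| ≤ t f² + q²/t` for `t > 0`; here as `q|f| ≤ (t f² + q²/t)/2`. [folklore] -/
theorem mul_abs_le_amgm {t : ℝ} (ht : 0 < t) (q f : ℝ) : q * |f| ≤ (t * f ^ 2 + q ^ 2 / t) / 2 := by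
  have h : 0 ≤ (t * |f| - q) ^ 2 / t := by positivity
  have he : (t * |f| - q) ^ 2 / t = t * f ^ 2 + q ^ 2 / t - 2 * (q * |f|) := by
    field_simp
    rw [← sq_abs f]; ring
  linarith [he ▸ h]

end Pointwise

/-! ### Sums against `Q`: `Q ∑J ≤ ∑(J² + Q²)/2` -/

section Sums

/-- `Q ∑_{k<j} J_k ≤ ∑_{k<N} (J_k² + Q²)/2` for `j ≤ N`. [folklore] -/
theorem mul_sum_le_sum_sq (J : ℕ → ℝ) (Q : ℝ) {j N : ℕ} (hjN : j ≤ N) :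
    Q * ∑ k ∈ Finset.range j, J k ≤ ∑ k ∈ Finset.range N, (J k ^ 2 + Q ^ 2) / 2 := by
  have h1 : Q * ∑ k ∈ Finset.range j, J k ≤ ∑ k ∈ Finset.range j, (J k ^ 2 + Q ^ 2) / 2 := by
    rw [Finset.mul_sum]
    refine Finset.sum_le_sum fun k _ => ?_
    nlinarith [sq_nonneg (J k - Q)]
  refine h1.trans (Finset.sum_le_sum_of_subset_of_nonneg (Finset.range_subset_range.mpr hjN) fun k _ _ => ?_)
  positivity

/-- `Q ∑_{i<j} i J_i ≤ N ∑_{k<N} (J_k² + Q²)/2` for `j ≤ N`, `J ≥ 0`, `Q ≥ 0`. [folklore] -/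
theorem mul_sum_mul_le_sum_sq {J : ℕ → ℝ} (hJ : ∀ k, 0 ≤ J k) {Q : ℝ} (hQ : 0 ≤ Q) {j N : ℕ} (hjN : j ≤ N) :
    Q * ∑ i ∈ Finset.range j, (i : ℝ) * J i ≤ N * ∑ k ∈ Finset.range N, (J k ^ 2 + Q ^ 2) / 2 := by
  have h1 : Q * ∑ i ∈ Finset.range j, (i : ℝ) * J i ≤ ∑ i ∈ Finset.range j, (N : ℝ) * ((J i ^ 2 + Q ^ 2) / 2) := by
    rw [Finset.mul_sum]
    refine Finset.sum_le_sum fun i hi => ?_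
    have hi' : (i : ℝ) ≤ N := by exact_mod_cast ((Finset.mem_range.mp hi).le.trans hjN)
    have h2 : Q * J i ≤ (J i ^ 2 + Q ^ 2) / 2 := by nlinarith [sq_nonneg (J i - Q)]
    calc Q * ((i : ℝ) * J i) = (i : ℝ) * (Q * J i) := by ring
      _ ≤ N * ((J i ^ 2 + Q ^ 2) / 2) := mul_le_mul hi' h2 (mul_nonneg hQ (hJ i)) (Nat.cast_nonneg _)
  refine h1.trans ?_
  rw [← Finset.mul_sum]
  refine mul_le_mul_of_nonneg_left ?_ (Nat.cast_nonneg _)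
  exact Finset.sum_le_sum_of_subset_of_nonneg (Finset.range_subset_range.mpr hjN) fun k _ _ => by positivity

end Sums

/-! ### The integral bounds -/

section Integral

variable {τ : ℝ → ℝ} {bm bp : ℝ}

-- keep the unifier from unfolding the trigonometric polynomials and the chain (expensive `whnf`)
attribute [local irreducible] pcP pcPx pcPd ahPhase igDelta

/-- **The `∑a_kℓ(B_k) Ψ_ε` term**: `∫ |∑a_kℓ(B_k)| |Ψ_ε| ≤ A_G (C_L + C_Θ) √(n+1)/(2wL)` given
`∫(∑a_kℓ(B_k))² ≤ C_L(n+1)/w²` and `∫Q² ≤ C_Θ` (AM–GM with `t = w/√(n+1)`). [folklore] -/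
theorem integral_ellPsi_le (hτ : ReducedLawHyp τ bm bp) (S : SmoothingField τ bm bp)
    {ρB : Measure ℝ} [IsProbabilityMeasure ρB]
    (hρ : ρB = volume.withDensity fun s => ENNReal.ofReal (τ s))
    {w x : ℝ} (hw0 : 0 < w) (hwR : w ≤ pcW (max |bm| |bp| + 1))
    {h G : ℝ → ℝ} (hh : Continuous h) {AG : ℝ} (hAG : ∀ y, |G y| ≤ AG)
    {n m₁ : ℕ} (hm₁ : m₁ ≤ n + 1) {L : ℝ} (hL : 0 < L) {ε : ℝ} (hε : 0 < ε) {CL CΘ : ℝ}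
    (hLa : ∫ b, (∑ k : Fin (n + 1), vaA w x (finExt b) k * S.ℓ (b k)) ^ 2
      ∂(Measure.pi fun _ : Fin (n + 1) => ρB) ≤ CL * (n + 1) / w ^ 2)
    (hQ : ∫ b, (Real.exp (duT w x h (finExt b) (n + 1)) / vaJ w x (finExt b) (n + 1)) ^ 2
      ∂(Measure.pi fun _ : Fin (n + 1) => ρB) ≤ CΘ) :
    ∫ b, |(∑ k : Fin (n + 1), vaA w x (finExt b) k * S.ℓ (b k)) * duPsi w x h S.ξ G (n + 1) m₁ L ε (finExt b)|
        ∂(Measure.pi fun _ : Fin (n + 1) => ρB) ≤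
      AG * ((CL + CΘ) * Real.sqrt (n + 1) / (2 * w * L)) := by
  set μ := (Measure.pi fun _ : Fin (n + 1) => ρB) with hμ
  set bstar : ℝ := max |bm| |bp| with hbstar
  set R : ℝ := bstar + 1 with hR
  have hbstar0 : 0 ≤ bstar := le_max_of_le_left (abs_nonneg _)
  have hR0 : 0 < R := by rw [hR]; linarith
  set s : ℝ := Real.sqrt (n + 1) with hs
  have hn1 : (0 : ℝ) < n + 1 := by positivity
  have hs0 : 0 < s := Real.sqrt_pos.mpr hn1
  have hss : s ^ 2 = n + 1 := Real.sq_sqrt hn1.le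
  set t : ℝ := w / s with ht
  have ht0 : 0 < t := div_pos hw0 hs0
  have hAG0 : 0 ≤ AG := (abs_nonneg _).trans (hAG 0)
  set La : (Fin (n + 1) → ℝ) → ℝ := fun b => ∑ k : Fin (n + 1), vaA w x (finExt b) k * S.ℓ (b k) with hLadef
  set Q : (Fin (n + 1) → ℝ) → ℝ := fun b =>
    Real.exp (duT w x h (finExt b) (n + 1)) / vaJ w x (finExt b) (n + 1) with hQdef
  -- integrability
  have hQc : ContinuousOn Q (Set.pi Set.univ fun _ : Fin (n + 1) => Set.Ioo (-R) R) :=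
    (Real.continuous_exp.comp_continuousOn (continuousOn_duT_pi hR0 hw0.le hwR x hh (n + 1))).div
      (continuousOn_vaJ_pi hR0 hw0.le hwR x (n + 1)) fun b _ => (vaJ_pos w x _ _).ne'
  have hQ2i : Integrable (fun b => Q b ^ 2) μ := (integrable_pi_of_continuousOn hτ hρ (hQc.pow 2)).2
  have hLa2i : Integrable (fun b => La b ^ 2) μ := by
    have hexp : ∀ b, La b ^ 2 = ∑ k : Fin (n + 1), ∑ l : Fin (n + 1),
        (vaA w x (finExt b) k * vaA w x (finExt b) l) * (S.ℓ (b k) * S.ℓ (b l)) := by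
      intro b
      rw [hLadef, sq, Finset.sum_mul_sum]
      exact Finset.sum_congr rfl fun k _ => Finset.sum_congr rfl fun l _ => by ring
    simp_rw [hexp]
    refine integrable_finsetSum _ fun k _ => integrable_finsetSum _ fun l _ => ?_
    obtain ⟨⟨C, hC⟩, hint⟩ := integrable_pi_of_continuousOn hτ hρ
      ((continuousOn_vaA_pi hR0 hw0.le hwR x k).mul (continuousOn_vaA_pi (n := n + 1) hR0 hw0.le hwR x l))
    exact (integrable_ell_mul_ell hτ S hρ k l).bdd_mul hint.aestronglyMeasurable hC
  -- pointwise AM–GM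
  have hpt : ∀ b, |La b * duPsi w x h S.ξ G (n + 1) m₁ L ε (finExt b)| ≤
      AG / L * ((t * La b ^ 2 + Q b ^ 2 / t) / 2) := by
    intro b
    have h1 := pointwise_ellPsi_le (finExt b) S.ξ_nonneg hm₁ hL hε hAG (La b) (w := w) (x := x) (h := h)
    refine h1.trans ?_
    rw [mul_assoc]
    refine mul_le_mul_of_nonneg_left (mul_abs_le_amgm ht0 (Q b) (La b)) (by positivity)
  calc ∫ b, |La b * duPsi w x h S.ξ G (n + 1) m₁ L ε (finExt b)| ∂μ
      ≤ ∫ b, AG / L * ((t * La b ^ 2 + Q b ^ 2 / t) / 2) ∂μ := by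
        refine integral_mono_of_nonneg (ae_of_all _ fun b => abs_nonneg _) ?_ (ae_of_all _ hpt)
        exact ((hLa2i.const_mul t).add (hQ2i.div_const t)).div_const 2 |>.const_mul _
    _ = AG / L * ((t * ∫ b, La b ^ 2 ∂μ + (∫ b, Q b ^ 2 ∂μ) / t) / 2) := by
        rw [integral_const_mul, integral_div, integral_add (hLa2i.const_mul t) (hQ2i.div_const t),
          integral_const_mul, integral_div]
    _ ≤ AG / L * ((t * (CL * (n + 1) / w ^ 2) + CΘ / t) / 2) := by gcongr
    _ = AG * ((CL + CΘ) * s / (2 * w * L)) := by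
        rw [ht, ← hss]
        field_simp

/-- **The error-bracket term**: `∫ |G(X_{n+1})| |VΨ_ε - g e^Tχ U/(U+ε)| ≤ A_G · bnd_err` in terms of
the second moments `∫J_i² ≤ C_J`, `∫Q² ≤ C_Θ`, `∫M₂², ∫M₃² ≤ C_M(n+1)³` (AM–GM with
`t₃ = 1/((n+1)√(n+1))`, `Q∑J ≤ ∑(J²+Q²)/2`). The majorant `bnd_err` is the explicit linear
combination displayed in the statement. [folklore] -/
theorem integral_err_le (hτ : ReducedLawHyp τ bm bp) (S : SmoothingField τ bm bp)
    {ρB : Measure ℝ} [IsProbabilityMeasure ρB]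
    (hρ : ρB = volume.withDensity fun s => ENNReal.ofReal (τ s))
    {w x : ℝ} (hw0 : 0 < w) (hwR : w ≤ pcW (max |bm| |bp| + 1))
    {h G : ℝ → ℝ} (hh : ContDiff ℝ 1 h) {H : ℝ} (hH : ∀ y, |h y| ≤ H)
    {AG : ℝ} (hAG : ∀ y, |G y| ≤ AG) {Ξ : ℝ} (hΞ : ∀ b, |deriv S.ξ b| ≤ Ξ)
    {n m₁ : ℕ} (hm₁ : m₁ ≤ n + 1) {L : ℝ} (hL : 0 < L) {ε : ℝ} (hε : 0 < ε) {Cχ : ℝ}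
    (hCχ : ∀ s, |duDChi L s| ≤ Cχ / L) (hsupp : ∀ s, duDChi L s ≠ 0 → L < s ∧ s < 2 * L)
    {CJ CΘ CM : ℝ}
    (hJ2 : ∀ i, i ≤ n + 1 → ∫ b, vaJ w x (finExt b) i ^ 2 ∂(Measure.pi fun _ : Fin (n + 1) => ρB) ≤ CJ)
    (hQ : ∫ b, (Real.exp (duT w x h (finExt b) (n + 1)) / vaJ w x (finExt b) (n + 1)) ^ 2
      ∂(Measure.pi fun _ : Fin (n + 1) => ρB) ≤ CΘ)
    (hM2 : ∫ b, (∑ i ∈ Finset.range (n + 1), finExt b i * Real.cos (2 * π * ahPhase w x (finExt b) i) *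
        (vaJ w x (finExt b) i * vaN w x (finExt b) S.ξ i)) ^ 2 ∂(Measure.pi fun _ : Fin (n + 1) => ρB) ≤
      CM * (n + 1) ^ 3)
    (hM3 : ∫ b, (∑ j ∈ Finset.range (n + 1), deriv h (ahPhase w x (finExt b) j) * finExt b j *
        (vaJ w x (finExt b) j * vaN w x (finExt b) S.ξ j)) ^ 2 ∂(Measure.pi fun _ : Fin (n + 1) => ρB) ≤
      CM * (n + 1) ^ 3) :
    ∫ b, |G (ahPhase w x (finExt b) (n + 1)) *
        (Real.exp (duT w x h (finExt b) (n + 1)) *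
            (∑ k ∈ Finset.range (n + 1), vaW w x (finExt b) S.ξ k * duDT w x h (finExt b) (n + 1) k) *
            duChi L (vaN w x (finExt b) S.ξ m₁) * (duU w x (finExt b) S.ξ (n + 1) + ε)⁻¹ +
          Real.exp (duT w x h (finExt b) (n + 1)) * (duDChi L (vaN w x (finExt b) S.ξ m₁) *
            ∑ k ∈ Finset.range (n + 1), vaW w x (finExt b) S.ξ k * vaDN w x (finExt b) S.ξ k m₁) *
            (duU w x (finExt b) S.ξ (n + 1) + ε)⁻¹ +
          Real.exp (duT w x h (finExt b) (n + 1)) * duChi L (vaN w x (finExt b) S.ξ m₁) *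
            (-(∑ k ∈ Finset.range (n + 1), vaW w x (finExt b) S.ξ k * duDU w x (finExt b) S.ξ (n + 1) k) /
              (duU w x (finExt b) S.ξ (n + 1) + ε) ^ 2))| ∂(Measure.pi fun _ : Fin (n + 1) => ρB) ≤
      AG * (w * (1 / ((n + 1) * Real.sqrt (n + 1))) / (2 * L) * (CM * (n + 1) ^ 3) +
        2 * π * igC w * (1 / ((n + 1) * Real.sqrt (n + 1))) / L * (CM * (n + 1) ^ 3) +
        (w / (2 * (1 / ((n + 1) * Real.sqrt (n + 1))) * L) +
          2 * π * igC w / ((1 / ((n + 1) * Real.sqrt (n + 1))) * L)) * CΘ +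
        (2 * H / L + (Cχ / L / L + 1 / L ^ 2) * (2 * π * Ξ / igC w + 4 * π * (n + 1)) +
          (56 * π * igC w ^ 2 * (max |bm| |bp|) ^ 2 * (n + 1) + 6 * π) / L) * ((n + 1) * (CJ + CΘ) / 2)) := by
  set μ := (Measure.pi fun _ : Fin (n + 1) => ρB) with hμ
  set bstar : ℝ := max |bm| |bp| with hbstar
  set R : ℝ := bstar + 1 with hR
  have hbstar0 : 0 ≤ bstar := le_max_of_le_left (abs_nonneg _)
  have hR0 : 0 < R := by rw [hR]; linarith
  have hwb : w ≤ pcW bstar := hwR.trans (pcW_antitone hbstar0 (by rw [hR]; linarith))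
  obtain ⟨hw2, -, -⟩ := pc_small hbstar0 hw0.le hwb (show |(0:ℝ)| ≤ bstar by rw [abs_zero]; exact hbstar0)
  have hwπ : π * w / 2 < 1 := by linarith
  have hc := igC_pos hw0 hwπ
  have hn1 : (0 : ℝ) < n + 1 := by positivity
  set s : ℝ := Real.sqrt (n + 1) with hs
  have hs0 : 0 < s := Real.sqrt_pos.mpr hn1
  have hss : s ^ 2 = n + 1 := Real.sq_sqrt hn1.le
  set t₃ : ℝ := 1 / ((n + 1) * s) with ht₃
  have ht₃0 : 0 < t₃ := by rw [ht₃]; positivity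
  have hAG0 : 0 ≤ AG := (abs_nonneg _).trans (hAG 0)
  have hH0 : 0 ≤ H := (abs_nonneg _).trans (hH 0)
  have hΞ0 : 0 ≤ Ξ := (abs_nonneg _).trans (hΞ 0)
  have hCχ0 : 0 ≤ Cχ / L := (abs_nonneg _).trans (hCχ 0)
  have hhc : Continuous h := hh.continuous
  have hh'c : Continuous (deriv h) := hh.continuous_deriv le_rfl
  have hξc : Continuous S.ξ := S.ξ_contDiff.continuous
  -- the random quantities
  set Jf : ℕ → (Fin (n + 1) → ℝ) → ℝ := fun i b => vaJ w x (finExt b) i with hJf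
  set Q : (Fin (n + 1) → ℝ) → ℝ := fun b =>
    Real.exp (duT w x h (finExt b) (n + 1)) / vaJ w x (finExt b) (n + 1) with hQdef
  set M2 : (Fin (n + 1) → ℝ) → ℝ := fun b => ∑ i ∈ Finset.range (n + 1),
    finExt b i * Real.cos (2 * π * ahPhase w x (finExt b) i) * (vaJ w x (finExt b) i * vaN w x (finExt b) S.ξ i)
    with hM2def
  set M3 : (Fin (n + 1) → ℝ) → ℝ := fun b => ∑ j ∈ Finset.range (n + 1),
    deriv h (ahPhase w x (finExt b) j) * finExt b j * (vaJ w x (finExt b) j * vaN w x (finExt b) S.ξ j)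
    with hM3def
  set S2 : (Fin (n + 1) → ℝ) → ℝ := fun b => ∑ k ∈ Finset.range (n + 1), (Jf k b ^ 2 + Q b ^ 2) / 2 with hS2
  -- coefficients
  set α₃ : ℝ := w * t₃ / (2 * L) with hα₃
  set α₂ : ℝ := 2 * π * igC w * t₃ / L with hα₂
  set αQ : ℝ := w / (2 * t₃ * L) + 2 * π * igC w / (t₃ * L) with hαQ
  set c56 : ℝ := 56 * π * igC w ^ 2 * bstar ^ 2 * (n + 1) + 6 * π with hc56
  set αS : ℝ := 2 * H / L + (Cχ / L / L + 1 / L ^ 2) * (2 * π * Ξ / igC w + 4 * π * (n + 1)) + c56 / L with hαS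
  have hα₃0 : 0 ≤ α₃ := by rw [hα₃]; positivity
  have hα₂0 : 0 ≤ α₂ := by rw [hα₂]; positivity
  have hαQ0 : 0 ≤ αQ := by rw [hαQ]; positivity
  have hc560 : 0 ≤ c56 := by rw [hc56]; positivity
  have hαS0 : 0 ≤ αS := by rw [hαS]; positivity
  set Maj : (Fin (n + 1) → ℝ) → ℝ := fun b => AG * (α₃ * M3 b ^ 2 + α₂ * M2 b ^ 2 + αQ * Q b ^ 2 + αS * S2 b)
    with hMaj
  -- continuity / integrability
  set U := (Set.pi Set.univ fun _ : Fin (n + 1) => Set.Ioo (-R) R) with hU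
  have hXc : ∀ j, ContinuousOn (fun b : Fin (n + 1) → ℝ => ahPhase w x (finExt b) j) U := fun j =>
    continuousOn_ahPhase_pi hR0 hw0.le hwR x j
  have hJc : ∀ i, ContinuousOn (Jf i) U := fun i => continuousOn_vaJ_pi hR0 hw0.le hwR x i
  have hNc : ∀ j, ContinuousOn (fun b : Fin (n + 1) → ℝ => vaN w x (finExt b) S.ξ j) U := fun j =>
    continuousOn_vaN_pi hR0 hw0.le hwR x hξc j
  have hQc : ContinuousOn Q U :=
    (Real.continuous_exp.comp_continuousOn (continuousOn_duT_pi hR0 hw0.le hwR x hhc (n + 1))).div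
      (hJc (n + 1)) fun b _ => (vaJ_pos w x _ _).ne'
  have hM2c : ContinuousOn M2 U := by
    refine continuousOn_finsetSum _ fun i _ => ?_
    exact (((continuous_finExt i).continuousOn.mul (Real.continuous_cos.comp_continuousOn
      (continuousOn_const.mul (hXc i)))).mul ((hJc i).mul (hNc i)))
  have hM3c : ContinuousOn M3 U := by
    refine continuousOn_finsetSum _ fun j _ => ?_
    exact (((hh'c.comp_continuousOn (hXc j)).mul (continuous_finExt j).continuousOn).mul ((hJc j).mul (hNc j)))
  have hS2c : ContinuousOn S2 U :=
    continuousOn_finsetSum _ fun k _ => (((hJc k).pow 2).add (hQc.pow 2)).div_const 2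
  have hM3i : Integrable (fun b => M3 b ^ 2) μ := (integrable_pi_of_continuousOn hτ hρ (hM3c.pow 2)).2
  have hM2i : Integrable (fun b => M2 b ^ 2) μ := (integrable_pi_of_continuousOn hτ hρ (hM2c.pow 2)).2
  have hQi : Integrable (fun b => Q b ^ 2) μ := (integrable_pi_of_continuousOn hτ hρ (hQc.pow 2)).2
  have hJ2i : ∀ k, Integrable (fun b => Jf k b ^ 2) μ := fun k => (integrable_pi_of_continuousOn hτ hρ ((hJc k).pow 2)).2
  have hS2i : Integrable S2 μ := (integrable_pi_of_continuousOn hτ hρ hS2c).2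
  have hMaji : Integrable Maj μ :=
    ((((hM3i.const_mul α₃).add (hM2i.const_mul α₂)).add (hQi.const_mul αQ)).add (hS2i.const_mul αS)).const_mul AG
  -- the pointwise bound on the cube
  have hae : ∀ᵐ b ∂μ, ∀ i, bm ≤ b i ∧ b i ≤ bp := ae_pi_cube hτ hρ (n + 1)
  have hpt : ∀ b : Fin (n + 1) → ℝ, (∀ i, bm ≤ b i ∧ b i ≤ bp) →
      |G (ahPhase w x (finExt b) (n + 1)) *
        (Real.exp (duT w x h (finExt b) (n + 1)) *
            (∑ k ∈ Finset.range (n + 1), vaW w x (finExt b) S.ξ k * duDT w x h (finExt b) (n + 1) k) *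
            duChi L (vaN w x (finExt b) S.ξ m₁) * (duU w x (finExt b) S.ξ (n + 1) + ε)⁻¹ +
          Real.exp (duT w x h (finExt b) (n + 1)) * (duDChi L (vaN w x (finExt b) S.ξ m₁) *
            ∑ k ∈ Finset.range (n + 1), vaW w x (finExt b) S.ξ k * vaDN w x (finExt b) S.ξ k m₁) *
            (duU w x (finExt b) S.ξ (n + 1) + ε)⁻¹ +
          Real.exp (duT w x h (finExt b) (n + 1)) * duChi L (vaN w x (finExt b) S.ξ m₁) *
            (-(∑ k ∈ Finset.range (n + 1), vaW w x (finExt b) S.ξ k * duDU w x (finExt b) S.ξ (n + 1) k) /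
              (duU w x (finExt b) S.ξ (n + 1) + ε) ^ 2))| ≤ Maj b := by
    intro b hb
    have hB : ∀ i, |finExt b i| ≤ bstar := fun i => abs_finExt_le hb i
    have h1 := pointwise_err_le (finExt b) hbstar0 hw0 hwb hB S.ξ_nonneg S.ξ_le_one hΞ hH hAG hm₁ hL hε
      hCχ hsupp (w := w) (x := x) (h := h) (G := G)
    refine h1.trans ?_
    have hQ0 : 0 ≤ Q b := by rw [hQdef]; exact div_nonneg (Real.exp_pos _).le (vaJ_pos w x _ _).le
    have hJ0 : ∀ k, 0 ≤ Jf k b := fun k => (vaJ_pos w x _ k).le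
    -- AM–GM on the martingale terms, `Q∑J ≤ S2`, `Q∑iJ ≤ (n+1)S2`
    have a3 := mul_abs_le_amgm ht₃0 (Q b) (M3 b)
    have a2 := mul_abs_le_amgm ht₃0 (Q b) (M2 b)
    have bJ : ∀ j, j ≤ n + 1 → Q b * ∑ k ∈ Finset.range j, vaJ w x (finExt b) k ≤ S2 b := fun j hj =>
      mul_sum_le_sum_sq (fun k => Jf k b) (Q b) hj
    have biJ : ∀ j, j ≤ n + 1 → Q b * ∑ i ∈ Finset.range j, (i : ℝ) * vaJ w x (finExt b) i ≤ (n + 1 : ℕ) * S2 b :=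
      fun j hj => mul_sum_mul_le_sum_sq hJ0 hQ0 hj
    have hS20 : 0 ≤ S2 b := Finset.sum_nonneg fun k _ => by positivity
    have hn1' : ((n + 1 : ℕ) : ℝ) = n + 1 := by push_cast; ring
    rw [hn1'] at biJ
    -- expand and compare slot by slot
    have key : AG * (Real.exp (duT w x h (finExt b) (n + 1)) / vaJ w x (finExt b) (n + 1)) *
        ((w * |M3 b| + 2 * H * ∑ k ∈ Finset.range (n + 1), vaJ w x (finExt b) k) / L +
          Cχ / L / L * (2 * π * Ξ / igC w * ∑ k ∈ Finset.range m₁, vaJ w x (finExt b) k +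
            4 * π * ∑ i ∈ Finset.range m₁, (i : ℝ) * vaJ w x (finExt b) i) +
          (4 * π * igC w * |M2 b| + (56 * π * igC w ^ 2 * bstar ^ 2 * (n + 1 : ℕ) + 6 * π) *
            ∑ i ∈ Finset.range (n + 1), vaJ w x (finExt b) i) / L +
          (2 * π * Ξ / igC w * ∑ k ∈ Finset.range (n + 1), vaJ w x (finExt b) k +
            4 * π * ∑ i ∈ Finset.range (n + 1), (i : ℝ) * vaJ w x (finExt b) i) / L ^ 2) =
        AG * ((w * (Q b * |M3 b|) + 2 * H * (Q b * ∑ k ∈ Finset.range (n + 1), vaJ w x (finExt b) k)) / L +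
          Cχ / L / L * (2 * π * Ξ / igC w * (Q b * ∑ k ∈ Finset.range m₁, vaJ w x (finExt b) k) +
            4 * π * (Q b * ∑ i ∈ Finset.range m₁, (i : ℝ) * vaJ w x (finExt b) i)) +
          (4 * π * igC w * (Q b * |M2 b|) + c56 * (Q b * ∑ i ∈ Finset.range (n + 1), vaJ w x (finExt b) i)) / L +
          (2 * π * Ξ / igC w * (Q b * ∑ k ∈ Finset.range (n + 1), vaJ w x (finExt b) k) +
            4 * π * (Q b * ∑ i ∈ Finset.range (n + 1), (i : ℝ) * vaJ w x (finExt b) i)) / L ^ 2) := by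
      rw [hc56, hQdef]; push_cast; ring
    rw [key]
    rw [hMaj]
    refine mul_le_mul_of_nonneg_left ?_ hAG0
    have hc1 : 0 ≤ 2 * π * Ξ / igC w := by positivity
    have hc2 : 0 ≤ 4 * π * igC w := by positivity
    have e1 : (w * (Q b * |M3 b|) + 2 * H * (Q b * ∑ k ∈ Finset.range (n + 1), vaJ w x (finExt b) k)) / L ≤
        (w * ((t₃ * M3 b ^ 2 + Q b ^ 2 / t₃) / 2) + 2 * H * S2 b) / L :=
      div_le_div_of_nonneg_right (add_le_add (mul_le_mul_of_nonneg_left a3 hw0.le)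
        (mul_le_mul_of_nonneg_left (bJ _ le_rfl) (by positivity))) hL.le
    have e2 : Cχ / L / L * (2 * π * Ξ / igC w * (Q b * ∑ k ∈ Finset.range m₁, vaJ w x (finExt b) k) +
          4 * π * (Q b * ∑ i ∈ Finset.range m₁, (i : ℝ) * vaJ w x (finExt b) i)) ≤
        Cχ / L / L * (2 * π * Ξ / igC w * S2 b + 4 * π * ((n + 1) * S2 b)) :=
      mul_le_mul_of_nonneg_left (add_le_add (mul_le_mul_of_nonneg_left (bJ _ hm₁) hc1)
        (mul_le_mul_of_nonneg_left (biJ _ hm₁) (by positivity))) (div_nonneg hCχ0 hL.le)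
    have e3 : (4 * π * igC w * (Q b * |M2 b|) + c56 * (Q b * ∑ i ∈ Finset.range (n + 1), vaJ w x (finExt b) i)) / L ≤
        (4 * π * igC w * ((t₃ * M2 b ^ 2 + Q b ^ 2 / t₃) / 2) + c56 * S2 b) / L :=
      div_le_div_of_nonneg_right (add_le_add (mul_le_mul_of_nonneg_left a2 hc2)
        (mul_le_mul_of_nonneg_left (bJ _ le_rfl) hc560)) hL.le
    have e4 : (2 * π * Ξ / igC w * (Q b * ∑ k ∈ Finset.range (n + 1), vaJ w x (finExt b) k) +
          4 * π * (Q b * ∑ i ∈ Finset.range (n + 1), (i : ℝ) * vaJ w x (finExt b) i)) / L ^ 2 ≤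
        (2 * π * Ξ / igC w * S2 b + 4 * π * ((n + 1) * S2 b)) / L ^ 2 :=
      div_le_div_of_nonneg_right (add_le_add (mul_le_mul_of_nonneg_left (bJ _ le_rfl) hc1)
        (mul_le_mul_of_nonneg_left (biJ _ le_rfl) (by positivity))) (sq_nonneg L)
    have htot := add_le_add (add_le_add (add_le_add e1 e2) e3) e4
    refine htot.trans (le_of_eq ?_)
    rw [hα₃, hα₂, hαQ, hαS]
    field_simp
    ring
  -- integrate
  calc _ ≤ ∫ b, Maj b ∂μ :=
        integral_mono_of_nonneg (ae_of_all _ fun b => abs_nonneg _) hMaji (hae.mono hpt)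
    _ = AG * (α₃ * ∫ b, M3 b ^ 2 ∂μ + α₂ * ∫ b, M2 b ^ 2 ∂μ + αQ * ∫ b, Q b ^ 2 ∂μ + αS * ∫ b, S2 b ∂μ) := by
        rw [hMaj]
        dsimp only
        rw [integral_const_mul, integral_add, integral_add, integral_add, integral_const_mul, integral_const_mul,
          integral_const_mul, integral_const_mul]
        · exact hM3i.const_mul _
        · exact hM2i.const_mul _
        · exact (hM3i.const_mul _).add (hM2i.const_mul _)
        · exact hQi.const_mul _
        · exact ((hM3i.const_mul _).add (hM2i.const_mul _)).add (hQi.const_mul _)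
        · exact hS2i.const_mul _
    _ ≤ AG * (α₃ * (CM * (n + 1) ^ 3) + α₂ * (CM * (n + 1) ^ 3) + αQ * CΘ + αS * ((n + 1) * (CJ + CΘ) / 2)) := by
        have hS2int : ∫ b, S2 b ∂μ ≤ (n + 1) * (CJ + CΘ) / 2 := by
          have hsplit : ∫ b, S2 b ∂μ = ∑ k ∈ Finset.range (n + 1), ∫ b, (Jf k b ^ 2 + Q b ^ 2) / 2 ∂μ := by
            rw [hS2]
            exact integral_finsetSum _ fun k _ => (((hJ2i k).add hQi).div_const 2)
          rw [hsplit]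
          calc ∑ k ∈ Finset.range (n + 1), ∫ b, (Jf k b ^ 2 + Q b ^ 2) / 2 ∂μ
              ≤ ∑ k ∈ Finset.range (n + 1), (CJ + CΘ) / 2 := by
                refine Finset.sum_le_sum fun k hk => ?_
                rw [integral_div, integral_add (hJ2i k) hQi]
                have hk' : k ≤ n + 1 := (Finset.mem_range.mp hk).le
                have := hJ2 k hk'
                gcongr
            _ = (n + 1) * (CJ + CΘ) / 2 := by
                rw [Finset.sum_const, Finset.card_range, nsmul_eq_mul]; push_cast; ring
        gcongr
    _ = _ := by rw [hα₃, hα₂, hαQ, hαS, hc56, ht₃]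

/-- **The `ε`-regularised integration by parts, bounded by second moments.** With `G' = g`
continuous, `|G| ≤ A_G`:
`|∫ g(X_{n+1}) e^T χ_L(N_{m₁}) U/(U+ε) dτ^{⊗(n+1)}| ≤ A_G (bnd_ℓ + bnd_err)`, where
`bnd_ℓ = (C_L + C_Θ)√(n+1)/(2wL)` (`integral_ellPsi_le`) and `bnd_err` is the majorant of
`integral_err_le` — by `VΨ_ε = g e^Tχ U/(U+ε) + G·(error bracket)` (`sum_vaW_mul_duD`) and
`∫ VΨ_ε = -∫ (∑a_kℓ(B_k))Ψ_ε` (`integral_sum_vaW_mul_duD_eq`). [folklore] -/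
theorem integral_core_le (hτ : ReducedLawHyp τ bm bp) (S : SmoothingField τ bm bp)
    {ρB : Measure ℝ} [IsProbabilityMeasure ρB]
    (hρ : ρB = volume.withDensity fun s => ENNReal.ofReal (τ s))
    {w x : ℝ} (hw0 : 0 < w) (hwR : w ≤ pcW (max |bm| |bp| + 1))
    {h G g : ℝ → ℝ} (hh : ContDiff ℝ 1 h) {H : ℝ} (hH : ∀ y, |h y| ≤ H)
    (hG : ∀ y, HasDerivAt G (g y) y) (hg : Continuous g)
    {AG : ℝ} (hAG : ∀ y, |G y| ≤ AG) {Ξ : ℝ} (hΞ : ∀ b, |deriv S.ξ b| ≤ Ξ)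
    {n m₁ : ℕ} (hm₁ : m₁ ≤ n + 1) {L : ℝ} (hL : 0 < L) {ε : ℝ} (hε : 0 < ε) {Cχ : ℝ}
    (hCχ : ∀ s, |duDChi L s| ≤ Cχ / L) (hsupp : ∀ s, duDChi L s ≠ 0 → L < s ∧ s < 2 * L)
    {CJ CΘ CM CL : ℝ}
    (hJ2 : ∀ i, i ≤ n + 1 → ∫ b, vaJ w x (finExt b) i ^ 2 ∂(Measure.pi fun _ : Fin (n + 1) => ρB) ≤ CJ)
    (hQ : ∫ b, (Real.exp (duT w x h (finExt b) (n + 1)) / vaJ w x (finExt b) (n + 1)) ^ 2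
      ∂(Measure.pi fun _ : Fin (n + 1) => ρB) ≤ CΘ)
    (hM2 : ∫ b, (∑ i ∈ Finset.range (n + 1), finExt b i * Real.cos (2 * π * ahPhase w x (finExt b) i) *
        (vaJ w x (finExt b) i * vaN w x (finExt b) S.ξ i)) ^ 2 ∂(Measure.pi fun _ : Fin (n + 1) => ρB) ≤
      CM * (n + 1) ^ 3)
    (hM3 : ∫ b, (∑ j ∈ Finset.range (n + 1), deriv h (ahPhase w x (finExt b) j) * finExt b j *
        (vaJ w x (finExt b) j * vaN w x (finExt b) S.ξ j)) ^ 2 ∂(Measure.pi fun _ : Fin (n + 1) => ρB) ≤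
      CM * (n + 1) ^ 3)
    (hLa : ∫ b, (∑ k : Fin (n + 1), vaA w x (finExt b) k * S.ℓ (b k)) ^ 2
      ∂(Measure.pi fun _ : Fin (n + 1) => ρB) ≤ CL * (n + 1) / w ^ 2) :
    |∫ b, g (ahPhase w x (finExt b) (n + 1)) * Real.exp (duT w x h (finExt b) (n + 1)) *
        duChi L (vaN w x (finExt b) S.ξ m₁) *
        (duU w x (finExt b) S.ξ (n + 1) * (duU w x (finExt b) S.ξ (n + 1) + ε)⁻¹)
        ∂(Measure.pi fun _ : Fin (n + 1) => ρB)| ≤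
      AG * ((CL + CΘ) * Real.sqrt (n + 1) / (2 * w * L)) +
      AG * (w * (1 / ((n + 1) * Real.sqrt (n + 1))) / (2 * L) * (CM * (n + 1) ^ 3) +
        2 * π * igC w * (1 / ((n + 1) * Real.sqrt (n + 1))) / L * (CM * (n + 1) ^ 3) +
        (w / (2 * (1 / ((n + 1) * Real.sqrt (n + 1))) * L) +
          2 * π * igC w / ((1 / ((n + 1) * Real.sqrt (n + 1))) * L)) * CΘ +
        (2 * H / L + (Cχ / L / L + 1 / L ^ 2) * (2 * π * Ξ / igC w + 4 * π * (n + 1)) +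
          (56 * π * igC w ^ 2 * (max |bm| |bp|) ^ 2 * (n + 1) + 6 * π) / L) * ((n + 1) * (CJ + CΘ) / 2)) := by
  set μ := (Measure.pi fun _ : Fin (n + 1) => ρB) with hμ
  have hell := integral_ellPsi_le hτ S hρ hw0 hwR hh.continuous hAG hm₁ hL hε hLa hQ (x := x) (G := G)
  have herr := integral_err_le hτ S hρ hw0 hwR hh hH hAG hΞ hm₁ hL hε hCχ hsupp hJ2 hQ hM2 hM3
    (x := x) (G := G)
  set bstar : ℝ := max |bm| |bp| with hbstar
  set R : ℝ := bstar + 1 with hR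
  have hbstar0 : 0 ≤ bstar := le_max_of_le_left (abs_nonneg _)
  have hR0 : 0 < R := by rw [hR]; linarith
  have hwb : w ≤ pcW bstar := hwR.trans (pcW_antitone hbstar0 (by rw [hR]; linarith))
  obtain ⟨hw2, -, -⟩ := pc_small hbstar0 hw0.le hwb (show |(0:ℝ)| ≤ bstar by rw [abs_zero]; exact hbstar0)
  have hwπ : π * w / 2 < 1 := by linarith
  have hhc : Continuous h := hh.continuous
  have hh'c : Continuous (deriv h) := hh.continuous_deriv le_rfl
  have hξc : Continuous S.ξ := S.ξ_contDiff.continuous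
  have hξ'c : Continuous (deriv S.ξ) := S.ξ_contDiff.continuous_deriv le_rfl
  have hGc : Continuous G := continuous_iff_continuousAt.mpr fun y => (hG y).continuousAt
  set U : Set (Fin (n + 1) → ℝ) := Set.pi Set.univ fun _ : Fin (n + 1) => Set.Ioo (-R) R with hU
  -- the three integrands
  set f₁ : (Fin (n + 1) → ℝ) → ℝ := fun b => g (ahPhase w x (finExt b) (n + 1)) *
    Real.exp (duT w x h (finExt b) (n + 1)) * duChi L (vaN w x (finExt b) S.ξ m₁) *
    (duU w x (finExt b) S.ξ (n + 1) * (duU w x (finExt b) S.ξ (n + 1) + ε)⁻¹) with hf₁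
  set fV : (Fin (n + 1) → ℝ) → ℝ := fun b =>
    ∑ k ∈ Finset.range (n + 1), vaW w x (finExt b) S.ξ k * duD w x h S.ξ G (n + 1) m₁ L ε (finExt b) g k with hfV
  set f₂ : (Fin (n + 1) → ℝ) → ℝ := fun b => G (ahPhase w x (finExt b) (n + 1)) *
        (Real.exp (duT w x h (finExt b) (n + 1)) *
            (∑ k ∈ Finset.range (n + 1), vaW w x (finExt b) S.ξ k * duDT w x h (finExt b) (n + 1) k) *
            duChi L (vaN w x (finExt b) S.ξ m₁) * (duU w x (finExt b) S.ξ (n + 1) + ε)⁻¹ +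
          Real.exp (duT w x h (finExt b) (n + 1)) * (duDChi L (vaN w x (finExt b) S.ξ m₁) *
            ∑ k ∈ Finset.range (n + 1), vaW w x (finExt b) S.ξ k * vaDN w x (finExt b) S.ξ k m₁) *
            (duU w x (finExt b) S.ξ (n + 1) + ε)⁻¹ +
          Real.exp (duT w x h (finExt b) (n + 1)) * duChi L (vaN w x (finExt b) S.ξ m₁) *
            (-(∑ k ∈ Finset.range (n + 1), vaW w x (finExt b) S.ξ k * duDU w x (finExt b) S.ξ (n + 1) k) /
              (duU w x (finExt b) S.ξ (n + 1) + ε) ^ 2)) with hf₂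
  have hid : ∀ b, fV b = f₁ b + f₂ b := fun b => by
    simp only [hfV, hf₁, hf₂]
    exact sum_vaW_mul_duD h (finExt b) hw0 hwπ S.ξ G g (n + 1) m₁ L ε
  -- continuity ⇒ integrability
  have hf₁c : ContinuousOn f₁ U := by
    have hX := continuousOn_ahPhase_pi (n := n + 1) hR0 hw0.le hwR x (n + 1)
    have hUc := continuousOn_duU_pi (n := n + 1) hR0 hw0.le hwR x hξc (n + 1)
    refine (((hg.comp_continuousOn hX).mul (Real.continuous_exp.comp_continuousOn
      (continuousOn_duT_pi hR0 hw0.le hwR x hhc (n + 1)))).mul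
      ((continuous_duChi L).comp_continuousOn (continuousOn_vaN_pi hR0 hw0.le hwR x hξc m₁))).mul ?_
    exact hUc.mul ((hUc.add continuousOn_const).inv₀ fun b _ => (duU_add_pos w x _ S.ξ_nonneg hε _).ne')
  have hfVc : ContinuousOn fV U := continuousOn_finsetSum _ fun k _ =>
    (continuousOn_vaW_pi hR0 hw0.le hwR x hξc k).mul
      (continuousOn_duD_pi hR0 hw0.le hwR x hhc hh'c hξc hξ'c S.ξ_nonneg hGc hg (n + 1) m₁ L hε k)
  have hf₂c : ContinuousOn f₂ U := by
    have : f₂ = fun b => fV b - f₁ b := funext fun b => by rw [hid b]; ring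
    rw [this]; exact hfVc.sub hf₁c
  have hf₁i : Integrable f₁ μ := (integrable_pi_of_continuousOn hτ hρ hf₁c).2
  have hf₂i : Integrable f₂ μ := (integrable_pi_of_continuousOn hτ hρ hf₂c).2
  -- the identity `∫ f₁ = -∫ ΛΨ - ∫ f₂`
  have hV : ∫ b, fV b ∂μ = -∫ b, (∑ k : Fin (n + 1), vaA w x (finExt b) k * S.ℓ (b k)) *
      duPsi w x h S.ξ G (n + 1) m₁ L ε (finExt b) ∂μ :=
    integral_sum_vaW_mul_duD_eq hτ S hρ hw0 hwR hh hG hg n m₁ L hε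
  have hsplit : ∫ b, fV b ∂μ = ∫ b, f₁ b ∂μ + ∫ b, f₂ b ∂μ := by
    rw [← integral_add hf₁i hf₂i]; exact integral_congr_ae (ae_of_all _ hid)
  have hI : ∫ b, f₁ b ∂μ = -∫ b, (∑ k : Fin (n + 1), vaA w x (finExt b) k * S.ℓ (b k)) *
      duPsi w x h S.ξ G (n + 1) m₁ L ε (finExt b) ∂μ - ∫ b, f₂ b ∂μ := by linarith
  rw [hI]
  calc |-∫ b, (∑ k : Fin (n + 1), vaA w x (finExt b) k * S.ℓ (b k)) *
          duPsi w x h S.ξ G (n + 1) m₁ L ε (finExt b) ∂μ - ∫ b, f₂ b ∂μ|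
      ≤ |∫ b, (∑ k : Fin (n + 1), vaA w x (finExt b) k * S.ℓ (b k)) *
          duPsi w x h S.ξ G (n + 1) m₁ L ε (finExt b) ∂μ| + |∫ b, f₂ b ∂μ| := by
        rw [show ∀ a c : ℝ, -a - c = -(a + c) from fun a c => by ring, abs_neg]; exact abs_add_le _ _
    _ ≤ ∫ b, |(∑ k : Fin (n + 1), vaA w x (finExt b) k * S.ℓ (b k)) *
          duPsi w x h S.ξ G (n + 1) m₁ L ε (finExt b)| ∂μ + ∫ b, |f₂ b| ∂μ :=
        add_le_add (abs_integral_le_integral_abs) (abs_integral_le_integral_abs)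
    _ ≤ _ := add_le_add hell herr

end Integral

/-! ### The second moments from `…Moments.lean` and `…Martingale.lean` -/

section Moments

variable {τ : ℝ → ℝ} {bm bp : ℝ}

-- keep the unifier from unfolding the trigonometric polynomials and the chain (expensive `whnf`)
attribute [local irreducible] pcP pcPx pcPd ahPhase igDelta

/-- **`𝔼J_i², 𝔼Q², 𝔼e^T, 𝔼e^{2T} = 𝒪(1)` for `w²(n+1) ≤ 1`** (joint exponential moments of the tilt and
the cocycle, `integral_tilt_mul_vaJ_rpow_le`). [cite: AjankiHuveneers2011, Lemma 4.2 eq. (4.4), Prop. 3.5 eqs. (3.19)-(3.21)] -/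
theorem moments_J_Q (hτ : ReducedLawHyp τ bm bp) {ρB : Measure ℝ} [IsProbabilityMeasure ρB]
    (hρ : ρB = volume.withDensity fun s => ENNReal.ofReal (τ s))
    {h : ℝ → ℝ} (hhm : Measurable h) {H : ℝ} (hH : ∀ y, |h y| ≤ H) :
    ∃ CJ CΘ : ℝ, 0 ≤ CJ ∧ 0 ≤ CΘ ∧ ∀ w ∈ Set.Ioc 0 (pcW (max |bm| |bp|)), ∀ n : ℕ,
      w ^ 2 * (n + 1) ≤ 1 → ∀ x : ℝ,
      (∀ i, i ≤ n + 1 →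
        Integrable (fun b : Fin (n + 1) → ℝ => vaJ w x (finExt b) i ^ 2) (Measure.pi fun _ : Fin (n + 1) => ρB) ∧
        ∫ b, vaJ w x (finExt b) i ^ 2 ∂(Measure.pi fun _ : Fin (n + 1) => ρB) ≤ CJ) ∧
      ∫ b, (Real.exp (duT w x h (finExt b) (n + 1)) / vaJ w x (finExt b) (n + 1)) ^ 2
          ∂(Measure.pi fun _ : Fin (n + 1) => ρB) ≤ CΘ ∧
      (Integrable (fun b : Fin (n + 1) → ℝ => Real.exp (duT w x h (finExt b) (n + 1)))
          (Measure.pi fun _ : Fin (n + 1) => ρB) ∧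
        ∫ b, Real.exp (duT w x h (finExt b) (n + 1)) ∂(Measure.pi fun _ : Fin (n + 1) => ρB) ≤ CΘ) ∧
      (Integrable (fun b : Fin (n + 1) → ℝ => Real.exp (duT w x h (finExt b) (n + 1)) ^ 2)
          (Measure.pi fun _ : Fin (n + 1) => ρB) ∧
        ∫ b, Real.exp (duT w x h (finExt b) (n + 1)) ^ 2 ∂(Measure.pi fun _ : Fin (n + 1) => ρB) ≤ CΘ) := by
  obtain ⟨C₁, hC₁0, hC₁⟩ := integral_tilt_mul_vaJ_rpow_le hτ hρ hhm hH 0 2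
  obtain ⟨C₂, hC₂0, hC₂⟩ := integral_tilt_mul_vaJ_rpow_le hτ hρ hhm hH 2 (-2)
  obtain ⟨C₃, hC₃0, hC₃⟩ := integral_tilt_mul_vaJ_rpow_le hτ hρ hhm hH 1 0
  obtain ⟨C₄, hC₄0, hC₄⟩ := integral_tilt_mul_vaJ_rpow_le hτ hρ hhm hH 2 0
  refine ⟨Real.exp C₁, Real.exp (max C₂ (max C₃ C₄)), (Real.exp_pos _).le, (Real.exp_pos _).le, ?_⟩
  intro w hw n hwn x
  have hexp : ∀ {C : ℝ}, 0 ≤ C → Real.exp (C * w ^ 2 * (n + 1 : ℕ)) ≤ Real.exp C := fun {C} hC => by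
    refine Real.exp_le_exp.mpr ?_
    have : C * (w ^ 2 * (n + 1)) ≤ C * 1 := mul_le_mul_of_nonneg_left hwn hC
    push_cast; nlinarith
  have hsum : ∀ b : Fin (n + 1) → ℝ, w * ∑ l ∈ Finset.range (n + 1), h (ahPhase w x (finExt b) l) * finExt b l =
      duT w x h (finExt b) (n + 1) := fun b => rfl
  refine ⟨fun i hi => ?_, ?_, ?_, ?_⟩
  · obtain ⟨hint, hle⟩ := hC₁ w hw (n + 1) i hi x
    have hfun : (fun b : Fin (n + 1) → ℝ =>
        Real.exp (0 * (w * ∑ l ∈ Finset.range (n + 1), h (ahPhase w x (finExt b) l) * finExt b l)) *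
          vaJ w x (finExt b) i ^ (2 : ℝ)) = fun b => vaJ w x (finExt b) i ^ 2 := by
      funext b; rw [zero_mul, Real.exp_zero, one_mul, Real.rpow_two]
    rw [hfun] at hint hle
    exact ⟨hint, hle.trans ((hexp hC₁0).trans (le_of_eq rfl))⟩
  · obtain ⟨-, hle⟩ := hC₂ w hw (n + 1) (n + 1) le_rfl x
    have hfun : (fun b : Fin (n + 1) → ℝ =>
        Real.exp (2 * (w * ∑ l ∈ Finset.range (n + 1), h (ahPhase w x (finExt b) l) * finExt b l)) *
          vaJ w x (finExt b) (n + 1) ^ (-2 : ℝ)) =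
        fun b => (Real.exp (duT w x h (finExt b) (n + 1)) / vaJ w x (finExt b) (n + 1)) ^ 2 := by
      funext b
      have hJ := vaJ_pos w x (finExt b) (n + 1)
      rw [hsum, show (2 : ℝ) * duT w x h (finExt b) (n + 1) = duT w x h (finExt b) (n + 1) * 2 by ring,
        Real.exp_mul, Real.rpow_two, Real.rpow_neg hJ.le, Real.rpow_two, div_pow]
      ring
    rw [hfun] at hle
    exact hle.trans ((hexp hC₂0).trans (Real.exp_le_exp.mpr (le_max_left _ _)))
  · obtain ⟨hint, hle⟩ := hC₃ w hw (n + 1) 0 (Nat.zero_le _) x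
    have hfun : (fun b : Fin (n + 1) → ℝ =>
        Real.exp (1 * (w * ∑ l ∈ Finset.range (n + 1), h (ahPhase w x (finExt b) l) * finExt b l)) *
          vaJ w x (finExt b) 0 ^ (0 : ℝ)) = fun b => Real.exp (duT w x h (finExt b) (n + 1)) := by
      funext b; rw [one_mul, Real.rpow_zero, mul_one, hsum]
    rw [hfun] at hint hle
    exact ⟨hint, hle.trans ((hexp hC₃0).trans (Real.exp_le_exp.mpr
      ((le_max_left _ _).trans (le_max_right _ _))))⟩
  · obtain ⟨hint, hle⟩ := hC₄ w hw (n + 1) 0 (Nat.zero_le _) x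
    have hfun : (fun b : Fin (n + 1) → ℝ =>
        Real.exp (2 * (w * ∑ l ∈ Finset.range (n + 1), h (ahPhase w x (finExt b) l) * finExt b l)) *
          vaJ w x (finExt b) 0 ^ (0 : ℝ)) = fun b => Real.exp (duT w x h (finExt b) (n + 1)) ^ 2 := by
      funext b; rw [Real.rpow_zero, mul_one, hsum, ← Real.exp_nat_mul]; norm_num
    rw [hfun] at hint hle
    exact ⟨hint, hle.trans ((hexp hC₄0).trans (Real.exp_le_exp.mpr
      ((le_max_right _ _).trans (le_max_right _ _))))⟩

/-- **The martingale transforms `M₂`, `M₃` and `∑a_kℓ(B_k)` have second moments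
`≤ 4b_*²C_J(n+1)³`, `≤ 4b_*²H'²C_J(n+1)³`, `≤ 4C_ℓC_J(n+1)/w²`** (orthogonality of increments,
`integral_sq_sum_predictable_le`, with the predictable coefficients `B ↦ cos(2πX_i)J_iN_i`,
`h'(X_j)J_jN_j`, `a_k = πJ_k/c(w)` and `𝔼J_k² ≤ C_J`). [cite: AjankiHuveneers2011, Lemma 4.2 (martingale structure); folklore] -/
theorem moments_martingale (hτ : ReducedLawHyp τ bm bp) (S : SmoothingField τ bm bp)
    {ρB : Measure ℝ} [IsProbabilityMeasure ρB]
    (hρ : ρB = volume.withDensity fun s => ENNReal.ofReal (τ s))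
    {w x : ℝ} (hw0 : 0 < w) (hwR : w ≤ pcW (max |bm| |bp| + 1))
    {h : ℝ → ℝ} (hh : ContDiff ℝ 1 h) {H' : ℝ} (hH' : ∀ y, |deriv h y| ≤ H') {n : ℕ} {CJ : ℝ}
    (hJ2 : ∀ i, i ≤ n + 1 →
      Integrable (fun b : Fin (n + 1) → ℝ => vaJ w x (finExt b) i ^ 2) (Measure.pi fun _ : Fin (n + 1) => ρB) ∧
      ∫ b, vaJ w x (finExt b) i ^ 2 ∂(Measure.pi fun _ : Fin (n + 1) => ρB) ≤ CJ)
    {Cℓ : ℝ} (hCℓ : ∫ t, S.ℓ t ^ 2 ∂ρB ≤ Cℓ) :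
    ∫ b, (∑ i ∈ Finset.range (n + 1), finExt b i * Real.cos (2 * π * ahPhase w x (finExt b) i) *
        (vaJ w x (finExt b) i * vaN w x (finExt b) S.ξ i)) ^ 2 ∂(Measure.pi fun _ : Fin (n + 1) => ρB) ≤
      4 * (max |bm| |bp|) ^ 2 * CJ * (n + 1) ^ 3 ∧
    ∫ b, (∑ j ∈ Finset.range (n + 1), deriv h (ahPhase w x (finExt b) j) * finExt b j *
        (vaJ w x (finExt b) j * vaN w x (finExt b) S.ξ j)) ^ 2 ∂(Measure.pi fun _ : Fin (n + 1) => ρB) ≤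
      4 * (max |bm| |bp|) ^ 2 * H' ^ 2 * CJ * (n + 1) ^ 3 ∧
    ∫ b, (∑ k : Fin (n + 1), vaA w x (finExt b) k * S.ℓ (b k)) ^ 2 ∂(Measure.pi fun _ : Fin (n + 1) => ρB) ≤
        4 * Cℓ * CJ * (n + 1) / w ^ 2 := by
  set μ := (Measure.pi fun _ : Fin (n + 1) => ρB) with hμ
  set bstar : ℝ := max |bm| |bp| with hbstar
  set R : ℝ := bstar + 1 with hR
  have hbstar0 : 0 ≤ bstar := le_max_of_le_left (abs_nonneg _)
  have hR0 : 0 < R := by rw [hR]; linarith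
  have hwb : w ≤ pcW bstar := hwR.trans (pcW_antitone hbstar0 (by rw [hR]; linarith))
  obtain ⟨hw2, -, -⟩ := pc_small hbstar0 hw0.le hwb (show |(0:ℝ)| ≤ bstar by rw [abs_zero]; exact hbstar0)
  have hwπ : π * w / 2 < 1 := by linarith
  have hc := igC_pos hw0 hwπ
  have hhc : Continuous h := hh.continuous
  have hh'c : Continuous (deriv h) := hh.continuous_deriv le_rfl
  have hξc : Continuous S.ξ := S.ξ_contDiff.continuous
  have hH'0 : 0 ≤ H' := (abs_nonneg _).trans (hH' 0)
  have hCJ0 : 0 ≤ CJ := le_trans (integral_nonneg fun b => sq_nonneg _) (hJ2 0 (Nat.zero_le _)).2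
  set U : Set (Fin (n + 1) → ℝ) := Set.pi Set.univ fun _ : Fin (n + 1) => Set.Ioo (-R) R with hU
  have hXc : ∀ j, ContinuousOn (fun b : Fin (n + 1) → ℝ => ahPhase w x (finExt b) j) U := fun j =>
    continuousOn_ahPhase_pi hR0 hw0.le hwR x j
  have hJc : ∀ i, ContinuousOn (fun b : Fin (n + 1) → ℝ => vaJ w x (finExt b) i) U := fun i =>
    continuousOn_vaJ_pi hR0 hw0.le hwR x i
  have hNc : ∀ j, ContinuousOn (fun b : Fin (n + 1) → ℝ => vaN w x (finExt b) S.ξ j) U := fun j =>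
    continuousOn_vaN_pi hR0 hw0.le hwR x hξc j
  -- the centred coordinate: `∫ t dρ = 0`, `∫ t² dρ ≤ b_*²`
  have hg0 : ∫ t, (fun t : ℝ => t) t ∂ρB = 0 := integral_id_rhoB hτ hρ
  have hv : ∫ t, (fun t : ℝ => t) t ^ 2 ∂ρB ≤ bstar ^ 2 := by
    have hae := ae_rhoB_mem_Icc hτ hρ
    calc ∫ t, (fun t : ℝ => t) t ^ 2 ∂ρB ≤ ∫ t, bstar ^ 2 ∂ρB := by
          refine integral_mono_of_nonneg (ae_of_all _ fun t => sq_nonneg _) (integrable_const _) ?_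
          filter_upwards [hae] with t ht
          have := ReducedLawHyp.abs_le_of_mem ht
          rw [← sq_abs]; exact pow_le_pow_left₀ (abs_nonneg _) this 2
      _ = bstar ^ 2 := by rw [integral_const, probReal_univ, one_smul]
  -- predictable coefficient bound: `∫ (f(X_k) J_k N_k)² ≤ F² 4 (n+1)² C_J`
  have hcoef : ∀ {f : ℝ → ℝ} {F : ℝ}, (∀ y, |f y| ≤ F) → Continuous f → ∀ k : Fin (n + 1),
      ∫ b, (f (ahPhase w x (finExt b) k) * (vaJ w x (finExt b) k * vaN w x (finExt b) S.ξ k)) ^ 2 ∂μ ≤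
        F ^ 2 * (4 * (n + 1) ^ 2 * CJ) := by
    intro f F hF hf k
    have hk : (k : ℕ) ≤ n + 1 := k.isLt.le
    obtain ⟨hint, hle⟩ := hJ2 k hk
    calc ∫ b, (f (ahPhase w x (finExt b) k) * (vaJ w x (finExt b) k * vaN w x (finExt b) S.ξ k)) ^ 2 ∂μ
        ≤ ∫ b, F ^ 2 * (4 * (n + 1) ^ 2) * vaJ w x (finExt b) k ^ 2 ∂μ := by
          refine integral_mono_of_nonneg (ae_of_all _ fun b => sq_nonneg _) (hint.const_mul _)
            (ae_of_all _ fun b => ?_)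
          have hN0 := vaN_nonneg (finExt b) w x S.ξ_nonneg k
          have hN := vaN_le (finExt b) w x S.ξ_le_one k (ξ := S.ξ)
          have hkk : (2 : ℝ) * k ≤ 2 * (n + 1) := by
            have : ((k : ℕ) : ℝ) ≤ n + 1 := by exact_mod_cast hk
            linarith
          have hJ := vaJ_pos w x (finExt b) k
          have h1 : |f (ahPhase w x (finExt b) k)| ≤ F := hF _
          have hF0 : 0 ≤ F := (abs_nonneg _).trans h1
          dsimp only
          rw [mul_pow, mul_pow, ← sq_abs (f _)]
          have h2 : vaN w x (finExt b) S.ξ k ^ 2 ≤ (2 * (n + 1)) ^ 2 :=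
            pow_le_pow_left₀ hN0 (hN.trans hkk) 2
          calc |f (ahPhase w x (finExt b) k)| ^ 2 * (vaJ w x (finExt b) k ^ 2 * vaN w x (finExt b) S.ξ k ^ 2)
              ≤ F ^ 2 * (vaJ w x (finExt b) k ^ 2 * (2 * (n + 1)) ^ 2) := by
                gcongr
            _ = F ^ 2 * (4 * (n + 1) ^ 2) * vaJ w x (finExt b) k ^ 2 := by ring
      _ = F ^ 2 * (4 * (n + 1) ^ 2) * ∫ b, vaJ w x (finExt b) k ^ 2 ∂μ := integral_const_mul _ _
      _ ≤ F ^ 2 * (4 * (n + 1) ^ 2) * CJ := by gcongr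
      _ = F ^ 2 * (4 * (n + 1) ^ 2 * CJ) := by ring
  -- the generic martingale bound for coefficients `f(X_k) J_k N_k`
  have hmart : ∀ {f : ℝ → ℝ} {F : ℝ}, (∀ y, |f y| ≤ F) → Continuous f →
      ∫ b, (∑ i ∈ Finset.range (n + 1), finExt b i * f (ahPhase w x (finExt b) i) *
        (vaJ w x (finExt b) i * vaN w x (finExt b) S.ξ i)) ^ 2 ∂μ ≤ 4 * bstar ^ 2 * F ^ 2 * CJ * (n + 1) ^ 3 := by
    intro f F hF hf
    set c : Fin (n + 1) → (Fin (n + 1) → ℝ) → ℝ := fun k b =>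
      f (ahPhase w x (finExt b) k) * (vaJ w x (finExt b) k * vaN w x (finExt b) S.ξ k) with hcdef
    have hpred : ∀ k j : Fin (n + 1), k ≤ j → ∀ B b, c k (update B j b) = c k B := by
      intro k j hkj B b
      have hkj' : (k : ℕ) ≤ j := hkj
      simp only [hcdef, finExt_update]
      rw [ahPhase_update_of_le w x _ hkj', vaJ_update_of_le w x _ hkj', vaN_update_of_le w x _ _ hkj']
    have hcc : ∀ k : Fin (n + 1), ContinuousOn (c k) U := fun k =>
      (hf.comp_continuousOn (hXc k)).mul ((hJc k).mul (hNc k))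
    have hI2 : ∀ k l : Fin (n + 1), Integrable (fun B => c k B * c l B * (fun t : ℝ => t) (B k) *
        (fun t : ℝ => t) (B l)) μ := fun k l =>
      (integrable_pi_of_continuousOn hτ hρ ((((hcc k).mul (hcc l)).mul
        (continuous_apply k).continuousOn).mul (continuous_apply l).continuousOn)).2
    have hmain := integral_sq_sum_predictable_le ρB c hpred (fun t : ℝ => t) hg0 hv hI2 Finset.univ
      (fun _ => F ^ 2 * (4 * (n + 1) ^ 2 * CJ)) (fun k _ => hcoef hF hf k)
    have hsumeq : ∀ b : Fin (n + 1) → ℝ, ∑ i ∈ Finset.range (n + 1), finExt b i * f (ahPhase w x (finExt b) i) *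
        (vaJ w x (finExt b) i * vaN w x (finExt b) S.ξ i) = ∑ k : Fin (n + 1), c k b * (fun t : ℝ => t) (b k) := by
      intro b
      rw [← Fin.sum_univ_eq_sum_range]
      refine Finset.sum_congr rfl fun k _ => ?_
      simp only [hcdef, finExt_of_lt _ k.isLt]; ring
    simp_rw [hsumeq]
    refine hmain.trans (le_of_eq ?_)
    rw [Finset.sum_const, Finset.card_univ, Fintype.card_fin, nsmul_eq_mul]
    push_cast; ring
  -- the `ℓ`-transform
  obtain ⟨hℓ0, -⟩ := integral_ell_rhoB hτ S hρ
  refine ⟨?_, ?_, ?_⟩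
  · have h1 := hmart (f := fun y => Real.cos (2 * π * y)) (F := 1) (fun y => Real.abs_cos_le_one _) (by fun_prop)
    have heq : ∀ b : Fin (n + 1) → ℝ, ∑ i ∈ Finset.range (n + 1), finExt b i * Real.cos (2 * π * ahPhase w x (finExt b) i) *
        (vaJ w x (finExt b) i * vaN w x (finExt b) S.ξ i) = ∑ i ∈ Finset.range (n + 1), finExt b i *
        (fun y => Real.cos (2 * π * y)) (ahPhase w x (finExt b) i) * (vaJ w x (finExt b) i * vaN w x (finExt b) S.ξ i) :=
      fun b => rfl
    simp_rw [heq]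
    refine h1.trans (le_of_eq (by ring))
  · have h1 := hmart hH' hh'c
    have heq : ∀ b : Fin (n + 1) → ℝ, ∑ j ∈ Finset.range (n + 1), deriv h (ahPhase w x (finExt b) j) * finExt b j *
        (vaJ w x (finExt b) j * vaN w x (finExt b) S.ξ j) = ∑ j ∈ Finset.range (n + 1), finExt b j *
        deriv h (ahPhase w x (finExt b) j) * (vaJ w x (finExt b) j * vaN w x (finExt b) S.ξ j) :=
      fun b => Finset.sum_congr rfl fun j _ => by ring
    simp_rw [heq]
    exact h1
  · set c : Fin (n + 1) → (Fin (n + 1) → ℝ) → ℝ := fun k b => vaA w x (finExt b) k with hcdef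
    have hpred : ∀ k j : Fin (n + 1), k ≤ j → ∀ B b, c k (update B j b) = c k B := by
      intro k j hkj B b
      have hkj' : (k : ℕ) ≤ j := hkj
      simp only [hcdef, finExt_update]
      rw [vaA_update_of_le w x _ hkj']
    have hcc : ∀ k : Fin (n + 1), ContinuousOn (c k) U := fun k => continuousOn_vaA_pi hR0 hw0.le hwR x k
    have hI2 : ∀ k l : Fin (n + 1), Integrable (fun B => c k B * c l B * S.ℓ (B k) * S.ℓ (B l)) μ := by
      intro k l
      obtain ⟨⟨C, hC⟩, hint⟩ := integrable_pi_of_continuousOn hτ hρ ((hcc k).mul (hcc l))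
      have := (integrable_ell_mul_ell hτ S hρ k l).bdd_mul hint.aestronglyMeasurable hC
      exact this.congr (ae_of_all _ fun b => by simp only [Pi.mul_apply]; ring)
    have hA : ∀ k ∈ (Finset.univ : Finset (Fin (n + 1))), ∫ b, c k b ^ 2 ∂μ ≤ 4 / w ^ 2 * CJ := by
      intro k _
      obtain ⟨hint, hle⟩ := hJ2 k k.isLt.le
      have hratio : (π / igC w) ^ 2 ≤ 4 / w ^ 2 := by
        have h1 : π / igC w ≤ 2 / w := by
          rw [div_le_div_iff₀ hc hw0]
          have := le_igC hw0.le hwπ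
          nlinarith
        have h0 : 0 ≤ π / igC w := by positivity
        calc (π / igC w) ^ 2 ≤ (2 / w) ^ 2 := pow_le_pow_left₀ h0 h1 2
          _ = 4 / w ^ 2 := by ring
      calc ∫ b, c k b ^ 2 ∂μ = ∫ b, (π / igC w) ^ 2 * vaJ w x (finExt b) k ^ 2 ∂μ := by
            refine integral_congr_ae (ae_of_all _ fun b => ?_)
            simp only [hcdef]; unfold vaA; ring
        _ = (π / igC w) ^ 2 * ∫ b, vaJ w x (finExt b) k ^ 2 ∂μ := integral_const_mul _ _
        _ ≤ 4 / w ^ 2 * CJ := mul_le_mul hratio hle (integral_nonneg fun b => sq_nonneg _) (by positivity)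
    have hmain := integral_sq_sum_predictable_le ρB c hpred S.ℓ hℓ0 hCℓ hI2 Finset.univ
      (fun _ => 4 / w ^ 2 * CJ) hA
    refine hmain.trans (le_of_eq ?_)
    rw [Finset.sum_const, Finset.card_univ, Fintype.card_fin, nsmul_eq_mul]
    field_simp
    push_cast; ring

end Moments

/-! ### The algebra: everything is `𝒪(1/(w√n))` -/

section Algebra

/-- `X ≤ K/(ws)` from `X · (ws) ≤ K`. [folklore] -/
theorem le_div_of_mul_ws_le {X K w s : ℝ} (hw : 0 < w) (hs : 0 < s) (h : X * (w * s) ≤ K) : X ≤ K / (w * s) := by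
  rw [le_div_iff₀ (mul_pos hw hs)]; exact h

/-- **The majorant of `integral_core_le` is `≤ A_G K₁/(w√(n+1))`** in the regime `w ≤ 1`,
`w²(n+1) ≤ 1`, `L ≥ ν(n+1)/2`, `πw/2 ≤ c(w) ≤ πw`, with
`K₁ = (C_L+C_Θ)/ν + (1+4π²)(C_M + C_Θ)/ν + (C_J+C_Θ)/2 · {4H/ν + 16(C_χ+1)Ξ/ν² + 16π(C_χ+1)/ν² + 112π³b_*²/ν + 12π/ν}`.
[folklore] -/
theorem core_bound_algebra {w s N L ν c AG CL CΘ CM CJ H Ξ Cχ bstar : ℝ} (hw0 : 0 < w)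
    (hs1 : 1 ≤ s) (hws : w * s ≤ 1) (hN : N = s ^ 2) (hν : 0 < ν) (hL0 : 0 < L) (hL : ν * N / 2 ≤ L)
    (hc_lo : π * w / 2 ≤ c) (hc_hi : c ≤ π * w) (hAG : 0 ≤ AG) (hCL : 0 ≤ CL) (hCΘ : 0 ≤ CΘ) (hCM : 0 ≤ CM)
    (hCJ : 0 ≤ CJ) (hH : 0 ≤ H) (hΞ : 0 ≤ Ξ) (hCχ : 0 ≤ Cχ) :
    AG * ((CL + CΘ) * s / (2 * w * L)) +
      AG * (w * (1 / (N * s)) / (2 * L) * (CM * N ^ 3) +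
        2 * π * c * (1 / (N * s)) / L * (CM * N ^ 3) +
        (w / (2 * (1 / (N * s)) * L) + 2 * π * c / ((1 / (N * s)) * L)) * CΘ +
        (2 * H / L + (Cχ / L / L + 1 / L ^ 2) * (2 * π * Ξ / c + 4 * π * N) +
          (56 * π * c ^ 2 * bstar ^ 2 * N + 6 * π) / L) * (N * (CJ + CΘ) / 2)) ≤
      AG * (((CL + CΘ) / ν + (1 + 4 * π ^ 2) * (CM + CΘ) / ν +
        (CJ + CΘ) / 2 * (4 * H / ν + 16 * (Cχ + 1) * Ξ / ν ^ 2 + 16 * π * (Cχ + 1) / ν ^ 2 +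
          112 * π ^ 3 * bstar ^ 2 / ν + 12 * π / ν)) / (w * s)) := by
  have hs0 : 0 < s := lt_of_lt_of_le one_pos hs1
  have hN0 : 0 < N := by rw [hN]; positivity
  have hNs : s ≤ N := by rw [hN]; nlinarith
  have hN1 : 1 ≤ N := hs1.trans hNs
  have hc0 : 0 < c := lt_of_lt_of_le (by positivity) hc_lo
  have hπ := Real.pi_pos
  have hws0 : 0 < w * s := mul_pos hw0 hs0
  -- basic monotonicity facts
  set iL : ℝ := 1 / L with hiL
  have hiL0 : 0 ≤ iL := by rw [hiL]; positivity
  have hLi : iL ≤ 2 / (ν * N) := by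
    rw [hiL, div_le_div_iff₀ hL0 (by positivity)]; linarith
  have hws2 : w ^ 2 * N ≤ 1 := by rw [hN]; nlinarith [mul_pos hw0 hs0]
  have hcwN : c * w * N ≤ π := by
    calc c * w * N ≤ (π * w) * w * N := by gcongr
      _ = π * (w ^ 2 * N) := by ring
      _ ≤ π * 1 := by gcongr
      _ = π := mul_one _
  have hic : 2 * π * Ξ / c ≤ 4 * Ξ / w := by
    rw [div_le_div_iff₀ hc0 hw0]
    have : 2 * π * Ξ * w = 4 * Ξ * (π * w / 2) := by ring
    rw [this]
    exact mul_le_mul_of_nonneg_left hc_lo (by positivity)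
  -- name the five terms
  set TA : ℝ := (CL + CΘ) * s / (2 * w * L) with hTA
  set TB : ℝ := w * (1 / (N * s)) / (2 * L) * (CM * N ^ 3) with hTB
  set TC : ℝ := 2 * π * c * (1 / (N * s)) / L * (CM * N ^ 3) with hTC
  set TD : ℝ := (w / (2 * (1 / (N * s)) * L) + 2 * π * c / ((1 / (N * s)) * L)) * CΘ with hTD
  set TE : ℝ := (2 * H / L + (Cχ / L / L + 1 / L ^ 2) * (2 * π * Ξ / c + 4 * π * N) +
    (56 * π * c ^ 2 * bstar ^ 2 * N + 6 * π) / L) * (N * (CJ + CΘ) / 2) with hTE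
  -- `T · (ws)` in closed form, then bounded
  have hA : TA * (w * s) ≤ (CL + CΘ) / ν := by
    have e : TA * (w * s) = (CL + CΘ) * N * iL / 2 := by
      rw [hTA, hiL, hN]; field_simp
    rw [e]
    calc (CL + CΘ) * N * iL / 2 ≤ (CL + CΘ) * N * (2 / (ν * N)) / 2 := by gcongr
      _ = (CL + CΘ) / ν := by field_simp
  have hB : TB * (w * s) ≤ CM / ν := by
    have e : TB * (w * s) = CM * (w ^ 2 * N) * N * iL / 2 := by
      rw [hTB, hiL]; field_simp
    rw [e]
    calc CM * (w ^ 2 * N) * N * iL / 2 ≤ CM * 1 * N * (2 / (ν * N)) / 2 := by gcongr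
      _ = CM / ν := by field_simp
  have hC : TC * (w * s) ≤ 4 * π ^ 2 * CM / ν := by
    have e : TC * (w * s) = 2 * π * CM * (c * w * N) * N * iL := by
      rw [hTC, hiL]; field_simp
    rw [e]
    calc 2 * π * CM * (c * w * N) * N * iL ≤ 2 * π * CM * π * N * (2 / (ν * N)) := by gcongr
      _ = 4 * π ^ 2 * CM / ν := by field_simp; ring
  have hD : TD * (w * s) ≤ (1 + 4 * π ^ 2) * CΘ / ν := by
    have e : TD * (w * s) = CΘ * N * iL * ((w ^ 2 * N) / 2 + 2 * π * (c * w * N)) := by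
      rw [hTD, hiL, hN]; field_simp
    rw [e]
    calc CΘ * N * iL * ((w ^ 2 * N) / 2 + 2 * π * (c * w * N))
        ≤ CΘ * N * (2 / (ν * N)) * (1 / 2 + 2 * π * π) := by gcongr
      _ = (1 + 4 * π ^ 2) * CΘ / ν := by field_simp; ring
  have hE : TE * (w * s) ≤ (CJ + CΘ) / 2 * (4 * H / ν + 16 * (Cχ + 1) * Ξ / ν ^ 2 +
      16 * π * (Cχ + 1) / ν ^ 2 + 112 * π ^ 3 * bstar ^ 2 / ν + 12 * π / ν) := by
    have e : TE * (w * s) = (CJ + CΘ) / 2 * (2 * H * N * (w * s) * iL +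
        (Cχ + 1) * iL ^ 2 * (2 * π * Ξ / c) * N * (w * s) + (Cχ + 1) * iL ^ 2 * (4 * π * N) * N * (w * s) +
        (56 * π * bstar ^ 2 * (c ^ 2 * N) + 6 * π) * iL * N * (w * s)) := by
      rw [hTE, hiL]; field_simp; ring
    rw [e]
    refine mul_le_mul_of_nonneg_left ?_ (by positivity)
    have hiL2 : iL ^ 2 ≤ (2 / (ν * N)) ^ 2 := pow_le_pow_left₀ hiL0 hLi 2
    have hc2 : c ^ 2 * N ≤ π ^ 2 := by
      calc c ^ 2 * N ≤ (π * w) ^ 2 * N := by gcongr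
        _ = π ^ 2 * (w ^ 2 * N) := by ring
        _ ≤ π ^ 2 * 1 := by gcongr
        _ = π ^ 2 := mul_one _
    have b1 : 2 * H * N * (w * s) * iL ≤ 4 * H / ν := by
      calc 2 * H * N * (w * s) * iL ≤ 2 * H * N * 1 * (2 / (ν * N)) := by gcongr
        _ = 4 * H / ν := by field_simp; ring
    have b2 : (Cχ + 1) * iL ^ 2 * (2 * π * Ξ / c) * N * (w * s) ≤ 16 * (Cχ + 1) * Ξ / ν ^ 2 := by
      calc (Cχ + 1) * iL ^ 2 * (2 * π * Ξ / c) * N * (w * s)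
          ≤ (Cχ + 1) * (2 / (ν * N)) ^ 2 * (4 * Ξ / w) * N * (w * s) := by gcongr
        _ = 16 * (Cχ + 1) * Ξ / ν ^ 2 * (s / N) := by field_simp; ring
        _ ≤ 16 * (Cχ + 1) * Ξ / ν ^ 2 * 1 := by gcongr; exact (div_le_one hN0).mpr hNs
        _ = 16 * (Cχ + 1) * Ξ / ν ^ 2 := mul_one _
    have b3 : (Cχ + 1) * iL ^ 2 * (4 * π * N) * N * (w * s) ≤ 16 * π * (Cχ + 1) / ν ^ 2 := by
      calc (Cχ + 1) * iL ^ 2 * (4 * π * N) * N * (w * s)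
          ≤ (Cχ + 1) * (2 / (ν * N)) ^ 2 * (4 * π * N) * N * 1 := by gcongr
        _ = 16 * π * (Cχ + 1) / ν ^ 2 := by field_simp; ring
    have b4 : (56 * π * bstar ^ 2 * (c ^ 2 * N) + 6 * π) * iL * N * (w * s) ≤
        112 * π ^ 3 * bstar ^ 2 / ν + 12 * π / ν := by
      calc (56 * π * bstar ^ 2 * (c ^ 2 * N) + 6 * π) * iL * N * (w * s)
          ≤ (56 * π * bstar ^ 2 * π ^ 2 + 6 * π) * (2 / (ν * N)) * N * 1 := by gcongr
        _ = 112 * π ^ 3 * bstar ^ 2 / ν + 12 * π / ν := by field_simp; ring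
    linarith [b1, b2, b3, b4]
  -- combine
  have hA' := le_div_of_mul_ws_le hw0 hs0 hA
  have hB' := le_div_of_mul_ws_le hw0 hs0 hB
  have hC' := le_div_of_mul_ws_le hw0 hs0 hC
  have hD' := le_div_of_mul_ws_le hw0 hs0 hD
  have hE' := le_div_of_mul_ws_le hw0 hs0 hE
  have hsum := add_le_add (add_le_add (add_le_add (add_le_add hA' hB') hC') hD') hE'
  calc AG * TA + AG * (TB + TC + TD + TE) = AG * (TA + TB + TC + TD + TE) := by ring
    _ ≤ AG * ((CL + CΘ) / ν / (w * s) + CM / ν / (w * s) + 4 * π ^ 2 * CM / ν / (w * s) +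
        (1 + 4 * π ^ 2) * CΘ / ν / (w * s) + (CJ + CΘ) / 2 * (4 * H / ν + 16 * (Cχ + 1) * Ξ / ν ^ 2 +
          16 * π * (Cχ + 1) / ν ^ 2 + 112 * π ^ 3 * bstar ^ 2 / ν + 12 * π / ν) / (w * s)) :=
        mul_le_mul_of_nonneg_left hsum hAG
    _ = _ := by field_simp; ring

end Algebra

end Literature.Barriers.AtomisticToContinuum.HeatConduction

end
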